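import Mathlib
import HarnessLib
import HarnessLib.Audit
import Summits.BirchSwinnertonDyer.Statement
import Literature.NumberTheory.EllipticCurves.Kato2004.EulerSystemClasses
import Literature.NumberTheory.EllipticCurves.Kato2004.IwasawaH1Reduction
import Literature.NumberTheory.GaloisCohomology.PoitouTate
import Summits.BirchSwinnertonDyer.BirchSwinnertonDyer.Theorems.Rank1ResidualX9MuTransfer
import Literature.NumberTheory.EllipticCurves.ModularCurvePeriodRatio
import Literature.NumberTheory.EllipticCurves.PAdicGrossZagier
import Literature.NumberTheory.EllipticCurves.EmertonPollackWeston2006.MuAnTransferGoodOrdinary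
import Summits.BirchSwinnertonDyer.BirchSwinnertonDyer.Theorems.SignedLowerHalvesRealPeriodUnitPlusPeriod
import Summits.BirchSwinnertonDyer.BirchSwinnertonDyer.Theorems.Rank1ResidualX9Defs
import HarnessLib.Audit.Status.Attr

/-!
Route: SmallImageMuTransfer

# Route SmallImageMuTransfer — BSD(E,p) on class X9 (irreducible non-surjective image) by Kato
μ-transfer without τ plus analytic μ = 0

It suffices to show X = X₁ ∧ X₂ ∧ X₃ (+ the published inputs P) on the residual class X9 = {(E, p):
E/ℚ non-CM on a global minimal model, p ≥ 5 good ordinary, E[p] IRREDUCIBLE but ρ̄_{E,p} NOT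
surjective} (images 5Ns, 5S4, 7Ns; ladder row A4, rung K6 of LADDER-BSD): X₁ = `MuTransfer` (:= the
tree's `Rank1Residual.KatoMuTransfer`, KOLY-MEMO v1.6 Thm 5.7.1 + Cor 5.7.2: at every good ordinary
p ≥ 5 with E[p] irreducible — no surjectivity, no Mazur–Rubin τ, no Kato (12.5.2) — one p-adic UNIT
coefficient of the cyclotomic L_p(f, α, T) forces μ = 0 for the Pontryagin dual of
Sel_{p^∞}(E/ℚ_∞)); X₂ = `AnalyticMuZeroX9` (:= `Rank1Residual.AnalyticMuZeroOnClassX9`, Greenberg's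
conjecture on the ANALYTIC side for the X9 pairs: L_p(f, α, T) ∉ pΛ); X₃ = `SchneiderX9RankOne`
(non-degeneracy of the canonical p-adic height on the rank-1 X9 pairs, rider C3). Then the rung-K6
leaf `BSDpOnClassX9` (the p-part of BSD, Miller Def. 1.1, at every X9 pair of analytic rank ≤ 1 with
Ш finite) follows by the kernel bridge `Rank1Residual.bsdpOnClassX9_of_katoMuTransfer` (p407118): μ
= 0 ⟹ Kato's divisibility is an integral EQUALITY of characteristic ideals (BCS 2025 Thm 1.1.2 (a) +
Kato 17.4) ⟹ BSD_p by the rank-0 (Greenberg 4.1) and rank-1 (Schneider 1985 / Perrin-Riou 1987 /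
Wuthrich 2014) leading-term engines already in the tree.
Lean: `MuTransfer ∧ AnalyticMuZeroX9 ∧ SchneiderX9RankOne ∧ PublishedInputsX9`

## Assembly
Certified in glue.lean (`closes`, sorry-free): `closes (hAsm : Assembly) (h1 : MuTransfer) (h2 :
AnalyticMuZeroX9) (h3 : SchneiderX9RankOne) (hP : PublishedInputsX9) : Rank1Residual.BSDpOnClassX9
:= hAsm h1 h2 h3 hP` — all five items consumed (BC6 cone = 5/5). The Assembly item itself is
PROVABLE NOW (checked in Sketch.lean): destructure hP into the eight facts and apply the
Theorems-side kernel bridge `Rank1Residual.bsdpOnClassX9_of_katoMuTransfer hBCS hGr h5 hS hPR hmodP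
hmodL hGZK h1 h2 h3` (p407118; its body: `mu_eq_zero_of_katoMuTransfer_of_analyticMuZero` →
`integralMainConjectureOnClassX9_of_katoMuTransfer` → rank-0 / rank-1 leading-term engines). Filing
`Theorems/SmallImageMuTransferAssembly.lean` (theorem `assembly_holds`) is staged for the first
prover.

CLOSES_TARGET: closes rung K6 of BirchSwinnertonDyer: Summit.BirchSwinnertonDyer.BirchSwinnertonDyer.Rank1Residual.BSDpOnClassX9 (D-0061; not the summit Statement) — the deciding theorem of this route concludes that registered leaf instead of the Statement decl `BirchSwinnertonDyer` (class rung: servable and labelled, never counted as concluding the summit Statement).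

Rationale: WHY THIS LINE. On X9 the integral cyclotomic main conjecture is known only up to the μ-part: Kato's
Euler-system divisibility (Kato2004Asterisque Thm 12.5/17.4) is integral at the height-one prime (p)
only under the big-image hypothesis «ρ ⊇ SL₂(ℤ_p)» (12.5.2) or Mazur–Rubin's τ (MazurRubin2004 §3.5
(H.2); Kato Thm 13.4 (3)), and the non-surjective irreducible images 5Ns/5S4/7Ns admit neither;
Burungale–Castella–Skinner (BurungaleCastellaSkinner2025 Thm 1.1.2 (a)) give the equality of
characteristic ideals in Λ[1/p] for every irreducible E[p]. The mechanism imported from the theory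
of Kolyvagin systems is the cell's μ-TRANSFER WITHOUT τ (KOLY-MEMO v1.6 §5.7 Thm 5.7.1 / Cor 5.7.2,
MU-TRANSFER-PROOF Theorem A + Cor B, refereed PASS in REF-KOLY-VERDICT v4/v4.1 and v10–v23): run
Kato's Euler system with coefficients Ω = Λ/p = 𝔽_p⟦T⟧ at ONE E-split tame prime whose local
condition has rank TWO (the Mazur–Rubin τ-hypothesis fails on ALL of X9: no non-identity element of
im ρ̄ ∩ SL₂(𝔽_p) has eigenvalue 1), control the error by Chebotarev at finite level and Poitou–Tate,
and kill the need for (im)/(ND) by the ι-semilinearity of the residual pairing (an alternating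
𝔽_p⟦T⟧-semilinear pairing cannot obstruct; polarisation for p ≠ 2 and E[p] irreducible — helper
GraphPairing p419785); «z_Kato ∉ p·𝐇¹» (= one unit coefficient of L_p) then forces Sel₀[p] finite,
hence μ(X) = 0. AS OF THIS REVISION (2026-08-27) THE MECHANISM IS KERNEL-CHECKED: the deciding child
MuTransferX9 is proved in the tree modulo ONE PUBLISHED named fact, Kato's zeta-element package F1 —
the other two hypotheses of the core being meanwhile TREE THEOREMS: Kato §13.8 (F2, proved in this
cell through the weak Lemma 8.5 (2), lur-a g2 p480014) and Poitou–Tate over ℚ (F3, bsd-cn100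
p475389) (items MuTransferX9Core p476037, KatoReductionModPKernel p480061,
PoitouTateSumLocalPairingsRat p477977 below; by name
`Theorems.smallImageMuTransfer_MuTransferX9_of_fine : F1 → MuTransferX9`, p480374, and for the
PARENT `…MuTransfer_of_fine : F1 → MuTransfer`, p482919). What remains open class-wide is typed
honestly as two further cruxes that are NAMED CONJECTURES, not lemmas: the ANALYTIC μ = 0 on X9
(Greenberg LNM 1716 Conj. 1.11 read through the main conjecture; in print only per pair, decidable
per pair by exact modular symbols) and Schneider's height non-degeneracy in rank 1 (Schneider1985,
PerrinRiou1987, Wuthrich2014, SteinWuthrich2013; decidable per pair by certified p-adic heights) —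
they are worked refutation-budget-first and per pair (the finite harvest over the 790-pair census is
the separate FRONTIER route K6-fin, director-bsd 2026-08-26T23:46:35Z), never staffed with provers
as if lemmas. Areas imported: Euler/Kolyvagin systems over 𝔽_p⟦T⟧ (Buyukboduk2011LambdaAdic,
Kurihara2014, MazurRubin2004, Howard2004HeegnerKolyvagin), cyclotomic Iwasawa theory
(GreenbergLNM1716, GreenbergVatsal2000, Kato2004Asterisque §§12–17), Poitou–Tate duality
(MilneADT2006 I 4.10 — now a tree theorem), p-adic heights, and the classification of mod-p images
(Serre1972, BiluParentRebolledo2013, BalakrishnanEtAl2019) confining X9 to p ∈ {5, 7}. No other open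
ledger route touches X9 (KatoTransfer / SelmerRank / PAdicOrderV2 assume surjectivity,
EisensteinPrimes = K5 is the reducible residue); the negatives index (TamePinch) is disjoint.

RANKED CRUXES. #2 MuTransfer (crux, stmt-19629) — Kato μ-transfer without τ, by name the tree's
`Rank1Residual.KatoMuTransfer`: for E/ℚ on a global minimal model, p ≥ 5 good ordinary with E[p]
irreducible (surjective OR not), f a newform of E, one p-adic unit coefficient of L_p(f, α, T)
forces μ(X(E/ℚ_∞)) = 0 for every cyclotomic Selmer-dual datum. SPLIT D2 (glue MuTransferSplit
CLOSED, p422630): MuTransfer ⇐ MuTransferX9 (crux, stmt-19276, the cell's whole new content) +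
MuTransferInputs (support, cite-only, HELD: `kato_divisibility` ∧ BCS (a) ∧ Rubin 1991 Thm 12.3 ∧
Greenberg–Vatsal 2000 Thm 1.4 ∧ A25 ∧ Carayol — the surjective and CM halves, helpers p415185 /
p417975; parent-level by-name records `Theorems.smallImageMuTransfer_MuTransfer_of_facts : F1 → F2 →
⟨the six MuTransferInputs conjuncts⟩ → MuTransfer`, k6-c2 g5 p478669, and `…_of_kato`, x10 g40
p481058). SINCE 2026-08-27T01:45Z THE PARENT TOO IS KERNEL-CHECKED MODULO F1 ALONE:
`Theorems.smallImageMuTransfer_MuTransfer_of_fine : F1 → MuTransfer` (k6-c2 g6, p482919) — the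
surjective branch is DERIVED from F1 (its `integral` field is Kato Thm 12.5 (4)/17.4 (3) under
surjectivity, typed verbatim as the `hint` binder of `Kato2004.kato_divisibility_body_of_skeleton`;
the characteristic ideal is principal over Λ by a tree theorem, so BCS (a) is not needed) and the
whole non-surjective branch, CM included, is b2b x10's `X10.mu_eq_zero_of_fine` (kernel core
`X10.coreTheoremAOddPrime_holds` UNCONDITIONAL, p480380, no ¬CM hypothesis) — so MuTransferInputs
(stmt-19277) is NO LONGER LOAD-BEARING (kept: its statement is consumed by the CLOSED glue, it is
held and never staffed; the D2 glue road is the longer alternative) and skeleton v3 bd1a221c (single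
stub F1 through p482919) is REGISTERED on 19629 (planner g12). STATE OF MuTransferX9
(2026-08-27T01Z): its conditional core MuTransferX9Core := F1 → F2 → F3 → <MuTransferX9 verbatim>
(support, stmt-19842, add-only edit D2b) is CLOSED `proved` by
`Theorems.smallImageMuTransfer_MuTransferX9Core_proof` (k6-c2 g4, p476037): Greenberg–Vatsal Prop
3.7 certificate ⟹ L_p ∉ pΛ ⟹ a GENUINE integral Λ-adic Euler-system class s ∉ p𝐇¹ (Kato 12.5/12.6 in
the fine-quotient currency) ⟹ `CoreAssembly.stub_coreX9_of_selmerDualOdd_of_stepsTwoFourOdd`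
(p452034) fed by the two registered stubs of skeleton v6, both theorems —
`SelmerDual.stub_selmerDualOdd_holds` (p465845, Selmer-dual control at finite level) and
`TameClass.stub_stepsTwoFourOdd_holds` (koly g9 p474398, the Kolyvagin package at one E-split tame
prime; per-hand credits HOME/STATUS l.378) — with Tate's local Euler–Poincaré characteristic a tree
theorem ⟹ Sel₀(ℚ_∞, E[p^∞])[p] finite ⟹ μ(X) = 0 (`Kato2004.lengthAt_X_le_lengthAt_fine`, p424676).
AND F2, F3 ARE THEOREMS: aside KatoReductionModPKernel (stmt-19844) :=
`Kato2004.mem_pSmul_of_red_eq_zero` (Kato §13.8: the kernel of reduction mod p on the pinned 𝐇¹ is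
p𝐇¹) is CLOSED `proved` (lur-a g2, p480061, 2026-08-27T00:57Z) through `UniversalNorms.stub_red` =
`UniversalNorms.mem_pSmul_of_red_eq_zero_holds` (p480014: k6-g4 g2's König-root reduction p475393 /
p477776 to the WEAK Lemma 8.5 (2) «a norm-compatible family whose p-multiples are integral is
integral», proved as `UniversalNorms.mem_integralH1_of_layerCores_eq_of_smul_mem`, p479589, with the
inert-step / p-power-period / inertia-torsion toolkit p479214 and k6-g3 g2's p477996 / p478340 /
p478890; the strong printed Lemma 8.5 (2) stays a named fact p477208 off the path; the `_holds` sits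
Summits-side because the inert step uses b2b `Derivative.*` lemmas — a librarian re-home under
`Kato2004/` would make the Literature fact formally discharged, statements unchanged); aside
PoitouTateSumLocalPairingsRat (stmt-19845) :=
`GaloisCohomology.poitouTate_sum_localTatePairing_eq_zero ℚ` is CLOSED `proved` (b2b x10 g40,
p477977) by `GaloisCohomology.poitouTate_sum_localTatePairing_eq_zero_holds` — the Poitou–Tate sum
formula for EVERY number field (cell bsd-cn100, p475389; MilneADT2006 I Thm 4.10 (b), Tate in
Cassels–Fröhlich VII §11). Hence the by-name theorems
`Theorems.smallImageMuTransfer_MuTransferX9_of_fine_red : F1 → F2 → MuTransferX9`,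
`…_of_fine_of_integral : F1 → h85w → MuTransferX9` (x10 g40, p478541) and the ONE-BINDER form
`Theorems.smallImageMuTransfer_MuTransferX9_of_fine : F1 → MuTransferX9` (x10 g40, p480374), and the
registered skeleton v8 (9f511c68…, k6-c2 g5, replacing v7 028a9c8f): `stub_inputsX9 : F1` OPEN
(PUB), `stub_red : F2` LANDED (p480014), `MuTransferX9_of := …MuTransferX9Core_proof stub_inputsX9
stub_red (…_holds ℚ)` (v9 25d7fe67 = the single stub F1 composed through p480374, REGISTERED by
planner g12 2026-08-27T01:40Z from k6-c2 g5's template; its definitional probe a24e4d0cba6f91ca — F1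
→ crux, F1 → leaf, crux → F1 without the Theorems closers — FAILS 3/3); the BC3 probes of the v7
stub set FAIL 4/4 in the post-closer environment (planner g12, 43a6b5a4d64e1961) and transfer to v8
(its stubs are F1 and the WEAKER F2); the degenerate-witness probe on F1 / F2 themselves FAILS 3/3
(planner g12, 6ede261415a989ad: no junk or library witness, so the closure is not vacuous on the
hypothesis side). OPEN SURFACE of #2 = ONE cite-only aside, closable BY NAME the minute its fact has
a `_holds`: F1 KatoZetaFineQuotientInputs (stmt-19843) :=
`Kato2004.exists_divisibilityInputs_fineQuotient_zeta` — Kato's zeta-element PACKAGE as one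
construction fact: the §17.13 four-term sequence 𝐇¹ ↪ P → X → 𝐇² → 𝐇²_loc with the Coleman injection
P ↪ Λ of finite cokernel (Prop 17.11), G = pⁿ·L_p(f, α, T) ∈ col(loc Z) (Thm 12.5 (1) with 16.6 —
the explicit reciprocity law), the Euler-system bound at the height-one primes away from p (Thm 12.5
(3) via 13.4 (2)), the surjective fine quotient X ↠ X₀ ((14.9.3)/(17.13.1)) and the Thm 12.6 span
clause Z ≤ span{classes of GENUINE integral Euler systems} (files Kato2004/DivisibilityInputs(Fine),
EulerSystemClasses; weaker than print, never stronger; not junk-satisfiable: `pow_mem` +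
`col_injective` + `ιG_eq` force Z to carry a class with Coleman image pⁿ·L_p) — THE PUBLISHED INPUT
OF THE RUNG (director-bsd 2026-08-26T23:46:35Z: «μ-transfer mod F1» counts as done for the harvest;
no port inside K6 — a port is Kato §§8–13 with §§16–17, XL ×3). 19276 and 19629 stay OPEN BY DESIGN
(unconditional text; each closes by ONE line from F1_holds — p480374 / p482919; leaf-level record
`Theorems/SmallImageMuTransferAssemblyOfX9.lean`, k6-c2 g5 p479408: the leaf from the X9 child
modulo F1, F2 — now a theorem —, the two named conjectures and the published inputs). [difficulty
now: PUB input XL (F1) only] (why it might fail, as of 2026-08-27: the MECHANISM can no longer fail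
— it is kernel-checked, and so are Kato §13.8 and Poitou–Tate; what can fail is (i) a MISSTATEMENT
of F1 relative to print (the typer's pin of Kato's 𝐇¹-datum `IwasawaH1Data`; the (17.13.1)/(17.13.3)
reading of P and the Thm 12.6 span clause inside F1) — an axiom audit of `DivisibilityInputs` field
by field against Thm 12.4/12.5/12.6, Prop 17.11 and (17.13.1)–(17.13.4) (lur-a's K6-FACT-1 audit of
`IwasawaH1Data` and k6-c2 g5's p. 280 reading note are the model) is exactly what exposes it, and a
misstated fact is repaired by restating the ASIDE and re-running the one-line closer, never by
touching MuTransferX9; (ii) nothing else — since p482919 the parent needs no cite-only input besides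
F1.) [Kato2004Asterisque, MazurRubin2004, BurungaleCastellaSkinner2025, GreenbergVatsal2000,
MilneADT2006, Rubin2000, Buyukboduk2011LambdaAdic, Kurihara2014, Howard2004HeegnerKolyvagin,
KimKimSun2020Selecta]
#3 AnalyticMuZeroX9 (crux, stmt-19630) — Greenberg's μ = 0 on the ANALYTIC side for class X9, by
name `Rank1Residual.AnalyticMuZeroOnClassX9`: for every X9 pair (E, p) and every newform f of E,
some coefficient of L_p(f, α, T) ∈ ℤ_p⟦T⟧ is a p-adic unit (L_p ∉ pΛ). A NAMED CONJECTURE class-wide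
(Greenberg LNM 1716 Conj. 1.11 is stated on the ALGEBRAIC side and is now a typed conjecture leaf,
`Rank1Residual.GreenbergMuConjecture(Irreducible)`, bsd-littype-11 p479948, whose edge
`GreenbergMu.x9Shape_of_irreducibleForm` p480725 supplies the leaf's per-pair binder hμ directly — a
Greenberg-CONDITIONAL display of BSDpOnClassX9 is thus available by name as a conditional bridge,
which is card/other-route territory, never a swap inside this route; #2 transfers μ_an = 0 to μ_alg
= 0, the direction used here); per pair a finite exact modular-symbol computation — records: book230
0 open cells ‖ 250, N3 two-engine μ-certificates (31 instances), KOLY-MEMO v1.7.1 numerical face 8/8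
(kit j246463); census 790 X9 pairs at N < 5·10⁵ (130 5Ns + 36 7Ns + 624 5S4), no exception wherever
a certificate was run, no class-wide certification (that finite statement is route K6-fin's). SPLIT
D1 (glue AnalyticMuZeroX9Split CLOSED, p418273): MuZeroCMCurves (crux, stmt-19234: Greenberg μ_an =
0 for the CM elliptic curves over ℚ with CM by a maximal order — the nine j of
`maximalCMJInvariants`, the four non-maximal class-number-one orders reducing to them by a
prime-to-p isogeny preserving A[p] — at good ordinary p ≥ 5 with A[p] irreducible, ϖ-normalised;
consumed by the glue only at CM partners of X9 members, i.e. p ∈ {5,7}, K ∈ {ℚ(i), ℚ(√−3), ℚ(√−11),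
ℚ(√−19)}; registered line katz-cyc-axis 6814be8e50ebea64: stub_translate PUB (Rubin1991 two-variable
lines (L3), p458898) → stub_katzFrame PUB modulo `DeShalit1987.thmII417_exists_katzSheet` + Deuring
+ ι (typer-shaped, brief plan/k6/briefs/BRIEF-19234-katzFrame.md) → stub_unitContentCycAxis OPEN =
unit content of Katz's two-variable measure on the line parallel to the cyclotomic axis through the
ψ_𝔭-branch — a NAMED OPEN PROBLEM in print (Gillard1991 p. 14: only the one-prime 𝔭-tower — Gillard,
Schneps, Oukhaba–Viguié — and the anticyclotomic line — Finis, Hida, Hsieh — are settled);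
composition via Rubin 1991 Thm 4.1 + `GreenbergVatsal2000.mu_eq_zero_iff_hasUnitContent`) +
AnalyticMuZeroX9NoCMPartner (crux, stmt-19235: the parent on the 699/790 pairs with no good-ordinary
CM elliptic partner, incl. all 624 of type 5S4; skeleton 05f45d2aa39320d7: stub_dihedral_noCM (75
dihedral pairs; the 73 imaginary ones have weight-2 CM NEWFORM partners in H(ρ̄)) →
stub_exceptional_noCM (5S4, the honest core)) + MuSplitInputs (support, cite-only, HELD: EPW 2006
Thm 1 analytic half ∧ A25 ∧ Carayol). [difficulty: conjecture-grade class-wide; per pair S] (why it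
might fail: the statement quantifies over infinitely many 5Ns/5S4/7Ns curves (genus-0 families);
μ_an > 0 with E[p] irreducible contradicts Greenberg's Conj. 1.11 but nothing in print excludes it,
and ONE curve with L_5(f, α, T) ∈ 5Λ refutes the item outright — hence refutation budget first
(standing disprover), provers only on the PUB-shaped stubs stub_katzFrame / stub_translate.)
[GreenbergLNM1716, GreenbergVatsal2000, EmertonPollackWeston2006, Rubin1991MainConj, deShalit1987,
Gillard1991, SteinWuthrich2013, BiluParentRebolledo2013, BalakrishnanEtAl2019]
#4 SchneiderX9RankOne (crux, stmt-19631) — Schneider's conjecture on the rank-1 part of X9: for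
every X9 pair (E, p) of analytic rank 1 and every CANONICAL p-adic height datum Dh, the cyclotomic
p-adic height pairing is non-degenerate (Reg_p ≠ 0) — the binder hC3 of the kernel bridge; by
Perrin-Riou's p-adic Gross–Zagier equivalent to ord_T L_p(f, α, T) = 1 on these pairs (skeleton
c23ac36b: stub_orderOne OPEN → stub_schneider_of_orderOne LANDED modulo hPR/hGZK/hmodP as
`Rank1Residual.schneider_of_orderOne_of_perrinRiou`, p415447). RIDER (tribunal round 2, judge
bsd-trib-j-1; director-bsd 2026-08-26T04:47:45Z (3)): load-bearing in `closes` as typed but not the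
line's deciding content; not a residual (t1r not-joint); shared verbatim by any alternative K6 road;
a NAMED CONJECTURE, worked refutation-first and per pair (certified p-adic heights — K6-fin), never
staffed as a lemma. A Schneider-FREE road for the rank-1 pairs exists in print shape and is CARDED,
not routed (card schneider-free-x9-twin-imc-bstw1111, c8e98862856c: X9 is twist-closed ⇒ #2 gives
the cyclotomic IMC for E and E^(d_K) ⇒ Burungale–Skinner–Tian–Wan 2024 Prop 11.11, typed OPEN-shaped
as `BurungaleSkinnerTianWan2024.prop1111_pPart_rankOne_of_mainStatements_ordinary_OPEN` p464403 ⇒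
BSD_p in rank 1 without Reg_p ≠ 0; director-bsd 23:46:35Z: HOLD as a card until graded, then
plancard — one route per rung). [difficulty: conjecture-grade class-wide; per pair S] (why it might
fail: a single rank-1 X9 curve whose generator has canonical 5-adic (or 7-adic) height zero —
equivalently [T¹]L_p(f, α) = 0 — refutes the crux; none among the rank-1 X9 pairs sampled by the
cell, but the class is infinite.) [Schneider1985, PerrinRiou1987, MazurSteinTate2006,
SteinWuthrich2013, Wuthrich2014, BurungaleSkinnerTianWan2024]
#9 PublishedInputsX9 (support, stmt-19632, text FROZEN REF v8-3, HELD) — the eight PUBLISHED named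
facts the kernel bridge `bsdpOnClassX9_of_katoMuTransfer` consumes: BCS 2025 Thm 1.1.2 (a),
Greenberg 1999 Thm 4.1 (rank-0 Euler characteristic), real period vs plus period unit relation
(A25), Schneider 1985 (order of the characteristic power series), Perrin-Riou 1987 rank-one leading
terms, modularity (parametrisation), entire L-function over ℚ, rank = analytic rank ≤ 1
(Gross–Zagier–Kolyvagin); SPLIT (rev 7) into seven by-name alias children
BCSCharIdealEqPadicLFunction / GreenbergCharValueRankZero / RealPeriodUnitPlusPeriod (19290, shared)
/ IwasawaLeadingTermFactsX9 / ModularParametrizationSupply (19266, shared) / EntireLFunctionRat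
(19273, shared) / RankEqAnalyticRankLeOne (19921, shared), all HELD, glued by
PublishedInputsX9OfParts (CLOSED, p427553); the cite-only constants of the layer-2 inputs items and
of F1/F2/F3 are item-stated as nine ASIDES (six for the inputs, three for the core;
KatoReductionModPKernel and PoitouTateSumLocalPairingsRat CLOSED), so every cite-only dependency of
the cone is declared BY NAME (readiness rule 2026-08-15; `route show`: staffable, 0 unproved deps of
430). [difficulty: provable-now conjunct by conjunct as `_holds` land]
[BurungaleCastellaSkinner2025, GreenbergLNM1716, Schneider1985, PerrinRiou1987, Wuthrich2014,
BCDT2001, GrossZagier1986, KolyvaginEulerSystems1990]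
RANKS UNCHANGED at this revision on purpose: #2 keeps rank 2 although its only open content is the
published input F1 — nothing is left to PROVE under it or under its child inside K6, and it must not
draw provers (a reversible staffing HOLD on 19276/19629 is announced for 2026-08-27T02:30Z,
HOME/STATUS l.404; director-bsd g6 GO 01:07:55Z); #3/#4 are not promoted — promoting a named
conjecture would only pull provers onto it (director-bsd 23:46:35Z). Glue items Assembly (19633,
p410648), MuTransferSplit (19278, p422630), AnalyticMuZeroX9Split (19237, p418273),
PublishedInputsX9OfParts (19462, p427553), MuTransferX9Core (19842, p476037) are all CLOSED, and so
are the asides KatoReductionModPKernel (19844, p480061) and PoitouTateSumLocalPairingsRat (19845,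
p477977); `closes` (five binders, bc6 5/5/0) is unchanged since birth.

TWO-LAYER PLAN. Layer 1 = the four binders of `closes` besides Assembly; layer 2 = the glued splits
D2 (MuTransfer → MuTransferX9 + MuTransferInputs), D1 (AnalyticMuZeroX9 → MuZeroCMCurves +
AnalyticMuZeroX9NoCMPartner + MuSplitInputs) and the alias split of PublishedInputsX9, plus the
add-only conditional core D2b (MuTransferX9Core + three asides, of which KatoReductionModPKernel
p480061 and PoitouTateSumLocalPairingsRat p477977 are CLOSED) — every seam PROVED and CLOSED
(p422630, p418273, p427553, p476037). No third layer (D-0019): below the items, lemmas ride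
`--supports <item>` (crux 19276 carries 55+ helper landings by koly, k6-c2, k6-g3, k6-g4, k6-ty,
lur-a, lur-b and b2b x9/x10 — the tally of record is HOME/STATUS l.378 and REF-KOLY-VERDICT v10–v23,
18/18 PASS in the last window). By-name closure arithmetic from here: F2_holds and F3_holds are in
the tree (19844, 19845 CLOSED); F1_holds ⟹ 19843 closes ⟹ `smallImageMuTransfer_MuTransferX9_of_fine
F1_holds` (one line `--workitem stmt-19276`) closes 19276, and
`smallImageMuTransfer_MuTransfer_of_fine F1_holds` (one line `--workitem stmt-19629`) closes 19629
DIRECTLY (p482919; the D2 glue road p422630 / p478669 / p481058 through MuTransferInputs is the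
longer alternative); AnalyticMuZeroX9 needs BOTH D1 children (conjecture-grade) + MuSplitInputs;
SchneiderX9RankOne needs stub_orderOne (conjecture-grade); PublishedInputsX9 needs its seven alias
children. Hence the honest resting state of the ROUTE (plan N2, director AGREED): no class-wide
close without two named conjectures (Greenberg μ_an = 0 on X9; Schneider in rank 1) and the
published inputs; DELIVERED is the mechanism — the first μ-transfer for non-surjective irreducible
images, kernel-checked modulo Kato's package — and the exact finite surface (per-pair μ_an
certificate, per-pair Reg_p ≠ 0) that the FRONTIER route K6-fin turns into BSD_p pair by pair.

KILL CRITERIA. A refutation of MuTransfer at one pair (a good ordinary p ≥ 5, E[p] irreducible, a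
unit coefficient of L_p but μ(X) > 0 certified, e.g. by a λ/μ mismatch against an isogenous curve)
would now contradict a kernel-checked theorem modulo F1 (F2 and Poitou–Tate being theorems), so it
would REFUTE F1 AS TYPED (misstatement) — first response: audit the pair's certificate, then the
`def … : Prop` text of F1 and the fields of `DivisibilityInputs` against Kato Thm 12.4–12.6 / Prop
17.11 / §17.13; the route is repaired by restating the aside, not closed. One X9 pair with L_p(f, α,
T) ∈ pΛ (exact modular symbols) refutes AnalyticMuZeroX9 (and its D1 child containing the pair); one
rank-1 X9 pair with vanishing canonical p-adic regulator refutes SchneiderX9RankOne — either closes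
the route `refuted:<Decl>` and, if the published inputs stand, refutes BSD_p or p-adic BSD for that
pair, so the first response is an audit of the pair's certificate; for SchneiderX9RankOne the repair
of record would be the carded Schneider-free road (BSTW24 Prop 11.11) as a separate rung route. If
BSDpOnClassX9 is closed by another road (a printed main conjecture for non-surjective irreducible
images, Fouquet–Wan style, or K6-bis), the route is mooted `superseded`.

NOT DECOMPOSED YET. Deliberately NOT itemised (D-0019, two layers at most): (i) the PORT of F1 — a
Literature fact with cite tags, discharged (if ever) by a `_holds` theorem in
`Literature/…/Kato2004/`, typer/literature-prover work of size XL ×3 (Kato §§8–13: zeta elements in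
K₂ of modular curves and their p-adic realisations; the explicit reciprocity law behind Thm 12.5
(1)/16.6; the Euler-system bound Thm 13.4; the Coleman map Prop 17.11) — per director-bsd g6
(2026-08-27T01:07:55Z, answer of record) NOT a K6 item: K6 RESTS at «kernel-checked modulo Kato
2004» (funnel J-K6-1) and the port is named on the cross-ladder literature-typing wishlist (D-0088)
as an XL referee target below every partition-moving job; never route items beyond the aside — F3's
port (global duality) WAS done, outside this route and for every number field
(`GaloisCohomology/PoitouTateNumberField.lean`, cell bsd-cn100, p475389); (ii) F2 — DONE (the weak
Lemma 8.5 (2) in the pin's currency, p479589 / p480014 / p480061; the only leftover is the librarian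
re-home that would mark the Literature fact discharged); (iii) the line under MuZeroCMCurves beyond
its registered skeleton (the independence statement lifting the Sinnott/Gillard one-prime ceiling to
the parallel line; BC5 rung of record U1 2026-08-18: 21/21 CM pairs certified by exact modular
symbols); (iv) the per-pair certificates (exact modular-symbol μ_an = 0 over the 790-pair census;
certified [T¹]L_p ≠ 0 / Reg_p ≠ 0 on the rank-1 pairs) — lines under AnalyticMuZeroX9NoCMPartner /
SchneiderX9RankOne here, ITEMS only in route K6-fin; (v) the TWIST CRITERION (p409544; KOLY-MEMO
§5.8, REF v5-2 PASS) and the Schneider-free K6-bis — ALTERNATIVE decompositions of the same leaf,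
separate routes sharing items if ever opened (the even-rank twist part is open in print, Prasanna
2010 p. 400; K6-bis is a card on HOLD), never swaps inside this one; (vi) the sibling X10b statement
at p = 3 (`KatoMuTransferThree`, p407527; now conditional on F1 only, F2 and Poitou–Tate being
theorems: `X10/CoreTheoremAOddPrimeOfFacts(PT).lean` p476063, and the typed kernel core
`X10.coreTheoremAOddPrime_holds` — a genuine Euler-system class outside p𝐇¹ kills Sel₀(E/ℚ_∞)[p] up
to T^J at every odd good-ordinary p with E[p] irreducible and ρ̄ non-surjective — UNCONDITIONAL, b2b
x10 g40 p480380) — NOT an item: the leaf is p ≥ 5.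

CHEAPEST FALSIFIER. For AnalyticMuZeroX9: recompute μ_an by exact plus modular symbols for the
smallest X9 pairs (the first 5S4, 5Ns and 7Ns curves of the census, conductor < 1 000) — one L_p ∈
pΛ kills the crux; the lane's records (book230: 0 open cells of 250; N3: 31 two-engine instances;
kit j246463: 8/8 census pairs) show a unit coefficient wherever a certificate was run. For
SchneiderX9RankOne: PARI `ellpadicheight` of the generator at p = 5, 7 on the rank-1 X9 curves of
conductor < 5 000 — a zero to working precision kills it. For MuTransfer (now: for F1 as typed): the
(λ, μ) tables of an isogenous/congruent pair with known μ (Greenberg–Vatsal transport) against the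
unit-coefficient certificate — a certified μ > 0 beside a unit coefficient refutes F1 as typed;
cheaper still, the axiom audit of `Kato2004.IwasawaH1Data` / `DivisibilityInputs` /
`exists_divisibilityInputs_fineQuotient_zeta` against Kato Thm 12.4–12.6, Prop 17.11 and
(17.13.1)–(17.13.4) line by line, and its dual, the degenerate-witness probe (`example :
exists_divisibilityInputs_fineQuotient_zeta := by exact? | aesop | simp` must FAIL — it does, 3/3,
planner g12 6ede261415a989ad).

NUMBERS. X9 census (bsd-smallim README §1 / KOLY-MEMO l.115 / b2b x9 g38 X9-CENSUS-G38 §4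
04ddd49fa8a87899): images 5Ns, 5S4 (p = 5), 7Ns (p = 7) only; 790 pairs at N < 5·10⁵ = 130 + 36 +
624; both analytic ranks occur; 91/790 have a good-ordinary CM elliptic partner (domain of D1's CM
anchor), 699/790 do not; μ_an = 0 RECORDS: book230 0 open cells ‖ 250, N3 two-engine μ-certificates
31 instances, KOLY-MEMO v1.7.1 numerical face 8/8 (kit j246463); no class-wide certification exists.
Kernel records: bridge p407118; ι-pairing p407217; X10b sibling p407527 (conditional twin p476063);
twist criterion p409544; Assembly p410648; glues p422630 / p418273 / p427553; conditional core
p476037 (F1/F2/F3 binders, conclusion BY NAME, axioms propext/Classical.choice/Quot.sound);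
Poitou–Tate for number fields p475389 (bsd-cn100) and the aside closer p477977; by-name F1 → F2 →
MuTransferX9 p478541; parent record p478669; stubs p465845 / p474398; composition p470966; core
assembly p452034; fine-to-X transfer p424676; F2 chain p473631 / p475393 / p477208 / p477776 /
p478363 (k6-g4 g2), p477996 / p478340 / p478890 (k6-g3 g2), p479214 / p479589 / p480014
(`UniversalNorms.stub_red`, stub credit) / p480061 (19844 CLOSED) (lur-a g2); leaf record p479408
(k6-c2 g5); parent modulo F1 alone p482919 (k6-c2 g6); X10 kernel core unconditional p480380 (x10
g40). Skeletons of record: 19276 v9 25d7fe67 (planner g12, 2026-08-27T01:40Z: single stub F1; v8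
9f511c68 k6-c2 g5: stubs F1 OPEN-PUB, F2 LANDED p480014; lineage v1 65ab9832 … v6 a90a661b … v7
028a9c8f; every registered stub set probed FAIL against crux and leaf, evidence
#3/#8/#10/#14/#29/#41, g12's v7 battery 43a6b5a4d64e1961 transferring to v8), 19234 katz-cyc-axis
6814be8e50ebea64 (birth e790166a inactive), 19235 05f45d2aa39320d7, 19631 c23ac36b, 19629 v3
bd1a221c (planner g12: single stub F1 through p482919; v2 e56656b3 superseded). Referee:
REF-KOLY-VERDICT v23 (2026-08-27T00:30Z): 18/18 PASS, 0 GAP, 0 SMUGGLED in the closing window;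
KOLY-MEMO v1.6 §5.7 PASS (v4 §6, v4.1-4), filing PASS (v5-1). Tribunal (D-0033): composed PASS r2,
tier B (R4 / A3.5 / L4 / B4 / K4; judge bsd-trib-j-1 a4f7484ab24be4a3), record-only addenda after
D2b: T1 #1 (23:10:45Z), T2 #1 10801ec9ef592cc8, J #3 1548c5da7aac397e — PASS persists, binders
unchanged.

DEFINITION REQUESTS. None open. Every notion of the items is in the tree (`ClassX9`,
`KatoMuTransfer`, `AnalyticMuZeroOnClassX9`, `SelmerDualData.mu`, `padicLFunction`, `unitRoot`,
`PAdicHeightData.IsCanonical`, `SchneiderConjecture`, the leaf `BSDpOnClassX9`); the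
Galois-cohomology vocabulary of the line under MuTransferX9 has LANDED
(defn-Kato2004.EulerSystemClasses p428434, defn-Kato2004.IwasawaH1Reduction p438005,
defn-IwasawaTwistModPDuality p433387, Shapiro p432507) and so has the two-variable CM dictionary for
MuZeroCMCurves (defn-Rubin1991.TwoVariableCMLines, p458898). A future port of F1 (cross-ladder
wishlist, D-0088; not K6) files its own definition items (K₂ of modular curves, p-adic realisation,
Coleman maps).

Novelty: Delta: an 𝔽_p⟦T⟧-integral Kolyvagin-system argument at ONE rank-two E[p^e]-split prime ((im)/(ND)
killed by ι-semilinearity) gives μ_an = 0 ⟹ μ_alg = 0 (crux MuTransferX9) WITHOUT Kato's τ /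
surjectivity — unprinted for non-surjective irreducible image.
Nearest prior art found: Kato2004Asterisque 13.4(3)/17.4(3) (μ under τ); Buyukboduk2011
[corpus:paper:arxiv-0706.0377] ((H.2) = τ); Kurihara2014 [corpus:paper:arxiv-1407.2465]
(surjective); Howard2004 3.2.4 [corpus:paper:arxiv-1202.6340] (ι-twist); KimKimSun2020
[corpus:paper:arxiv-1709.05780]; BurungaleCastellaSkinner2025 1.1.2(a); EmertonPollackWeston2006 Thm
1; Greenberg Conj 1.11 [corpus:book:coates1999-arithmetic-theory-elliptic-curves p.64]; Wuthrich2006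
Prop 7 [corpus:paper:doi-10-4310-mrl-2006-v13-n5-a3 p.717] (converse); DeoRaySujatha2023
[corpus:paper:arxiv-2202.09937]; LimSujatha2018 Prop 3.2. None gives μ_an = 0 ⟹ μ_alg = 0 on X9.
Searches (corpus fts+vec + galaxy, 08-25/26): --hybrid ×4 (Kato μ non-surjective | Greenberg μ = 0 |
one divisibility) → surveys only
[corpus:book:delbourgo2008-elliptic-curves-big-galois-representations p.164]; vsearch idem; galaxy
«μ-invariant vanishes|mu-invariant vanishes» --star all → 0, «Kato's Euler system|Kolyvagin systems»
→ 20, nearest [galaxy:pdf:7779040638471793060]; negatives TamePinch only; no other X9 route.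
Claimed grade: new-mechanism (non-surjective half of MuTransferX9), else new-combination. Long form:
HOME plan/k6/edit/novelty_rev15_full.txt.  [refs: paper:arxiv-0706.0377, paper:arxiv-1407.2465, paper:arxiv-1202.6340, paper:arxiv-1709.05780, book:coates1999-arithmetic-theory-elliptic-curves, paper:doi-10-4310-mrl-2006-v13-n5-a3, paper:arxiv-2202.09937, book:delbourgo2008-elliptic-curves-big-galois-representations, Kurihara2014, Howard2004, KimKimSun2020, BurungaleCastellaSkinner2025, EmertonPollackWeston2006, Wuthrich2006, DeoRaySujatha2023, L]

Barriers (technique_class: iwasawa-main-conjecture, kolyvagin-systems, padic-heights): - technique_class: iwasawa-main-conjecture, kolyvagin-systems, padic-heights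
- Literature.Barriers.BirchSwinnertonDyer.PAdicHeightBarrier: not evaded — crux SchneiderX9RankOne
IS it (rank-1 Reg_p ≠ 0), declared; other cruxes height-free.
- Literature.Barriers.BirchSwinnertonDyer.PAdicHeightBarrierNarrow: same, declared; bet: per-pair
certificates.
- Literature.Barriers.BirchSwinnertonDyer.ExceptionalZeroBarrier: out of scope — good ordinary p: no
trivial zero / 𝓛-invariant.
- Literature.Barriers.BirchSwinnertonDyer.ExceptionalZeroBarrierNarrow: out of scope likewise.
- Literature.Barriers.BirchSwinnertonDyer.SelmerRankBarrier: out of scope — analytic rank ≤ 1,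
rank/Ш-finiteness from GZK; no p-converse.
- Literature.Barriers.BirchSwinnertonDyer.SelmerRankBarrierNarrow: out of scope — no parity/average
step.
- Literature.Barriers.BirchSwinnertonDyer.HeegnerPointBarrier: inside by design (rank ≤ 1); Kato's
system, whose τ-ceiling on μ MuTransfer lifts — declared.
- Literature.Barriers.BirchSwinnertonDyer.HeegnerPointBarrierNarrow: inside; nothing claimed in rank
≥ 2.
- Literature.Barriers.BirchSwinnertonDyer.AnticyclotomicHeightDegeneracy: evaded — cyclotomic height
over ℚ only; ι acts on the residual KS pairing.
- Literature.Barriers.BirchSwinnertonDyer.EisensteinMuBarrier: outside its locus (E[p] REDUCIBLE);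
all cruxes carry HasIrreducibleModPGaloisRep; no isogeny crossed.
- Negatives: TamePinch only. Full text: HOME plan/k6/edit/barriers_rev15_full.txt.

History (route lifecycle, newest last):
- 2026-08-26T08:38:57Z · rev 12: informal re-worded for AnalyticMuZeroX9 (planner-bsd-smallim-plan-g6-0)
- 2026-08-26T08:39:25Z · rev 13: informal re-worded for MuZeroCMCurves (planner-bsd-smallim-plan-g6-0)
- 2026-08-27T01:33:25Z · rev 20: informal re-worded for MuTransferX9Core (planner-bsd-smallim-plan-g12-0)
- 2026-08-27T01:35:06Z · rev 21: informal re-worded for MuTransferX9 (planner-bsd-smallim-plan-g12-0)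
- 2026-08-27T01:35:35Z · rev 22: informal re-worded for MuTransfer (planner-bsd-smallim-plan-g12-0)
- 2026-08-27T01:43:16Z · rev 25: informal re-worded for MuTransfer (planner-bsd-smallim-plan-g12-0)

sub-problem: BirchSwinnertonDyer · status: open · opened planner-bsd-smallim-plan-g0-0 2026-08-25T22:02:58Z · rev 25 · ledger route-BirchSwinnertonDyer-SmallImageMuTransfer
GENERATED by the gate from the ledger (D-0016/17). Provers cite these decls: `theorem foo : Summit.BirchSwinnertonDyer.BirchSwinnertonDyer.Theses.SmallImageMuTransfer.<Decl> := …` in Summits/BirchSwinnertonDyer/BirchSwinnertonDyer/Theorems/<Name>.lean.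
-/

namespace Summit.BirchSwinnertonDyer.BirchSwinnertonDyer.Theses.SmallImageMuTransfer

open scoped BigOperators Topology Manifold Classical MeasureTheory ProbabilityTheory Matrix InnerProductSpace ComplexConjugate ContinuousMap
open Filter Set Function TopologicalSpace MeasureTheory

attribute [summit_statement] _root_.BirchSwinnertonDyer
attribute [summit_statement] _root_.Summit.BirchSwinnertonDyer.BirchSwinnertonDyer.Rank1Residual.BSDpOnClassX9

open Literature

/-- item stmt-BirchSwinnertonDyer-19629 · crux · rank 2 · SPLIT (gen 1) into MuTransferX9, MuTransferInputs + glue MuTransferSplit · direct attempts still welcome (low priority) · by planner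
why it might fail: Kernel-checked modulo published input F1 ALONE since p482919 (`…MuTransfer_of_fine : F1 → MuTransfer`; surjective branch from F1's `integral` field = Kato 17.4 (3), non-surjective incl. CM from the X10 core p480380); failure mode = F1 MISSTATED vs Kato Thm 12.4–12.6 / §17.13 (repair at aside 19843).
sources: Kato2004Asterisque Thm. 12.5, 12.6, 17.4(3), §17.13 (p. 280), MazurRubin2004 §3.5, §5.2, BurungaleCastellaSkinner2025 Thm. A (a), Rubin1991 Thm. 12.3, GreenbergVatsal2000 Thm. 1.4, pub-bsd-smallim/koly/KOLY-MEMO.md v1.8.5 §5.7 (e430d411450cf224)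
[crux] Kato μ-transfer without τ (KOLY-MEMO v1.6 Thm 5.7.1 + Cor 5.7.2), by name the tree's
`Rank1Residual.KatoMuTransfer`: for E/ℚ on a global minimal model, p ≥ 5 good ordinary with E[p]
irreducible (surjective OR not), f a newform of E, if some coefficient of the cyclotomic p-adic
L-function L_p(f, α, T) (α the unit root) is a p-adic unit then μ(X(E/ℚ_∞)) = 0 for every cyclotomic
Selmer-dual datum. STATE 2026-08-27: KERNEL-CHECKED MODULO THE PUBLISHED INPUT F1 ALONE —
`Theorems.smallImageMuTransfer_MuTransfer_of_fine : F1 → MuTransfer` (k6-c2 g6, p482919): the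
non-surjective case (CM included) is the cell's theorem through the X10/X9 kernel core (p480380 /
child MuTransferX9 p476037, p480374), the surjective case is derived from F1's own `integral` field
(Kato 12.5 (4)/17.4 (3)) with char ideals principal over Λ; the split D2 road through
MuTransferInputs (cite-only; records p478669 / p481058) is the longer alternative, no longer
load-bearing. F1 = `Kato2004.exists_divisibilityInputs_fineQuotient_zeta` (aside 19843; director-bsd
2026-08-27T01:07:55Z: K6 RESTS here); skeleton v3 = single stub F1. OPEN BY DESIGN until F1 has a
`_holds`. [difficulty now: PUB input only] -/
@[route_item "route-BirchSwinnertonDyer-SmallImageMuTransfer", crux]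
def MuTransfer : Prop :=
  Summit.BirchSwinnertonDyer.BirchSwinnertonDyer.Rank1Residual.KatoMuTransfer

-- parent: MuTransfer · child (gen 1)
/--     item stmt-BirchSwinnertonDyer-19276 · crux · rank 201 · open
    parent: MuTransfer · by planner
    why it might fail: Mechanism KERNEL-CHECKED (core p476037; F2 p480014 and F3 p475389 theorems; `…MuTransferX9_of_fine : F1 → MuTransferX9` p480374). Open content = published input F1 (Kato zeta-element package, aside 19843); failure mode = F1 MISSTATED vs Kato Thm 12.4–12.6/Prop 17.11/§17.13 — repaired at the aside.
    sources: Kato2004Asterisque Thm. 12.4–12.6, Prop. 17.11, §13.4 (2), §13.8, (14.9.3), §17.13 (p. 280), MazurRubin2004 Prop. 1.3.2, §4.4, MilneADT2006 I Thm 4.10 (b); NeukirchSchmidtWingberg2008 (8.6.10) — tree theorem poitouTate_sum_localTatePairing_eq_zero_holds p475389, pub-bsd-smallim/koly/MU-TRANSFER-PROOF.md §§1–6 (Theorem A, Cor B); KOLY-MEMO v1.6 §5.7 Thm 5.7.1 / Cor 5.7.2, REF-KOLY-VERDICT v23/v24 (2026-08-27: ALL PASS, 0 GAP, 0 SMUGGLED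 through p480374), p476037 Theorems.smallImageMuTransfer_MuTransferX9Core_proof (F1 → F2 → F3 → MuTransferX9); p478541 …MuTransferX9_of_fine_red; p480374 …MuTransferX9_of_fine (F1 → MuTransferX9)
[crux] Kato mu-transfer ON CLASS X9 ITSELF (non-CM, p >= 5 good ordinary, E[p] irreducible, rho-bar
not surjective — Rank1Residual.ClassX9 verbatim; p in {5,7} by the published classification): one
unit coefficient of L_p(f, alpha) forces mu(X(E/Q_infty)) = 0 for every cyclotomic dual datum — the
WHOLE new content of MuTransfer (surjective and CM cases published: sibling MuTransferInputs). STATE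
2026-08-27: KERNEL-CHECKED MODULO F1 ALONE — `Theorems.smallImageMuTransfer_MuTransferX9_of_fine :
F1 → MuTransferX9` (p480374) through the CLOSED conditional core MuTransferX9Core (19842, p476037:
KOLY-MEMO Thm 5.7.1 / MU-TRANSFER-PROOF Thm A — Λ/p Kolyvagin system at one E-split tame prime),
whose other hypotheses are theorems: F2 Kato §13.8 (`UniversalNorms.stub_red` p480014; aside 19844
CLOSED), F3 Poitou–Tate over ℚ (p475389; aside 19845 CLOSED). F1 =
`Kato2004.exists_divisibilityInputs_fineQuotient_zeta` (Kato's zeta-element package; aside 19843) is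
the rung's PUBLISHED INPUT (director-bsd 2026-08-27T01:07:55Z: K6 RESTS here); skeleton v8 9f511c68
/ v9 = single stub F1. OPEN BY DESIGN until F1 has a `_holds`; no prover work remains inside K6. -/
@[route_item "route-BirchSwinnertonDyer-SmallImageMuTransfer"]
def MuTransferX9 : Prop :=
  ∀ (W : WeierstrassCurve ℚ) [W.IsElliptic] [W.IsGloballyMinimal] (p : ℕ) [Fact p.Prime] {N : ℕ} [NeZero N] (f : CuspForm (CongruenceSubgroup.Gamma0 N) 2), Summit.BirchSwinnertonDyer.BirchSwinnertonDyer.Rank1Residual.ClassX9 W p → Literature.NumberTheory.EllipticCurves.ModularForms.IsNewformOf W f → (∃ n : ℕ, ‖PowerSeries.coeff n (Literature.NumberTheory.EllipticCurves.padicLFunction f (Literature.NumberTheory.EllipticCurves.unitRoot W p : ℚ_[p]))‖ = 1) → ∀ (κ : Literature.NumberTheory.EllipticCurves.ZpExtension ℚ p) (γ : Field.absoluteGaloisGroup ℚ), κ.IsCyclotomic → κ.IsTopGenerator γ → Literature.NumberTheory.EllipticCurves.IsCyclotomicVariable p γ → ∀ D : W.SelmerDualData κ γ, D.mu = 0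

-- parent: MuTransfer · child (gen 1)
/--     item stmt-BirchSwinnertonDyer-19277 · aside · rank 202 · open
    parent: MuTransfer · by planner
    why it might fail: cite-only bundle of published theorems; fails only if a transcription is wrong (e.g. kato_divisibility clause 3 needs surjectivity mod p^n for all n, supplied in the helper from surjectivity mod p and p >= 5 by Serre's lifting lemma).
    sources: Kato2004Asterisque Thm. 17.4 (p. 273), BurungaleCastellaSkinner2025 Thm. A (a), Rubin1991 Thm. 12.3 (p. 67), GreenbergVatsal2000 Thm. 1.4, Carayol1986
[support, cite-only] The PUBLISHED inputs of the two non-X9 cases of MuTransfer, bundled verbatim as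
the tree's named facts: Kato 2004 Thm 17.4 divisibility (kato_divisibility, every cyclotomic datum
and newform), Burungale-Castella-Skinner 2025 (a) (integral main conjecture at surjective image),
Rubin 1991 Thm 12.3 (CM cyclotomic main conjecture, maximal order), Greenberg-Vatsal 2000 Thm 1.4
(main-conjecture transfer along E[p]-isomorphisms, used for non-maximal CM orders), the period unit
A25 (realPeriodRat_eq_unit_mul_plusPeriod) and Carayol's level = conductor. Exactly the hypotheses
of the LANDED helpers Theorems.smallImageMuTransfer_stub_surj_of_kato_of_bcs (p415185) and
Rank1Residual.smallImageMuTransfer_stub_cm_of_rubin_of_gv (p417975). Never staffed for proof; closes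
only if every conjunct becomes a theorem. Kept separate from the frozen PublishedInputsX9 (REF v8-3)
and from MuSplitInputs (two conjuncts shared, harmless). -/
@[route_item "route-BirchSwinnertonDyer-SmallImageMuTransfer"]
def MuTransferInputs : Prop :=
  (∀ (W : WeierstrassCurve ℚ) [W.IsElliptic] [W.IsGloballyMinimal] (p : ℕ) [Fact p.Prime] (κ : Literature.NumberTheory.EllipticCurves.ZpExtension ℚ p) (γ : Field.absoluteGaloisGroup ℚ) (N : ℕ) [NeZero N] (f : CuspForm (CongruenceSubgroup.Gamma0 N) 2), Literature.NumberTheory.EllipticCurves.kato_divisibility W p (κ := κ) (γ := γ) (f := f)) ∧ Literature.NumberTheory.EllipticCurves.burungale_castella_skinner_charIdeal_eq_padicLFunction ∧ Literature.NumberTheory.EllipticCurves.Rubin1991.thm123_charIdeal_eq_padicLFunction_of_cm ∧ Literature.NumberTheory.EllipticCurves.GreenbergVatsal2000.thm14_mainConjecture_transfer_of_torsionIso ∧ Literature.NumberTheory.EllipticCurves.realPeriodRat_eq_unit_mul_plusPeriod ∧ (∀ (N : ℕ) [NeZero N], Literature.NumberTheory.EllipticCurves.ModularForms.IsNewformOf.level_eq_conductorNorm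 (N := N))

-- parent: MuTransfer · glue (gen 1)
/--     item stmt-BirchSwinnertonDyer-19278 · support · rank 203 · closed · proved by Summit.BirchSwinnertonDyer.BirchSwinnertonDyer.Theorems.smallImageMuTransfer_MuTransferSplit_proof (prover)
    parent: MuTransfer · GLUE: children ⟹ parent · by planner
excluded middle on surjectivity of rho-bar mod p, then on CM: the surjective case is Kato 2004 Thm
17.4(3) mu-part + BCS (a) (landed helper Theorems.smallImageMuTransfer_stub_surj_of_kato_of_bcs,
p415185), the CM case is Rubin 1991 Thm 12.3 + Greenberg-Vatsal Thm 1.4 + A25 + Carayol (landed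
helper Rank1Residual.smallImageMuTransfer_stub_cm_of_rubin_of_gv, p417975), both fed from
MuTransferInputs; the remaining case is ClassX9 verbatim = MuTransferX9. Proof READY:
plan/k6/split2/SplitMuTransfer.lean::muTransfer_of_split2 (sha16 0f63780b9d7e495b, farm rc 0, 0
sorry) - a prover ports it into Theorems/ to close this glue item -/
@[route_item "route-BirchSwinnertonDyer-SmallImageMuTransfer"]
def MuTransferSplit : Prop :=
  MuTransferX9 → MuTransferInputs → MuTransfer

-- `MuTransferSplit` holds: proved by `Summit.BirchSwinnertonDyer.BirchSwinnertonDyer.Theorems.smallImageMuTransfer_MuTransferSplit_proof` (its module imports this route file, so no `_holds` link can be stated here).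

/-- item stmt-BirchSwinnertonDyer-19630 · crux · rank 3 · SPLIT (gen 1) into MuZeroCMCurves, AnalyticMuZeroX9NoCMPartner, MuSplitInputs + glue AnalyticMuZeroX9Split · direct attempts still welcome (low priority) · by planner
why it might fail: μ_an > 0 does occur for irreducible E[p] in principle only if Greenberg's Conj. 1.11 fails; but the statement is class-wide over infinitely many 5Ns/5S4/7Ns curves (genus-0 families), and one curve with L_5(f, α, T) ∈ 5Λ (e.g. forced by a degenerate 5-adic multiplier) refutes it outright.
sources: GreenbergLNM1716, GreenbergVatsal2000, EmertonPollackWeston2006, SteinWuthrich2013, BiluParentRebolledo2013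
[crux] Greenberg's μ = 0 on the ANALYTIC side for class X9, by name the tree's
`Rank1Residual.AnalyticMuZeroOnClassX9`: for every X9 pair (E, p) and every newform f of E, some
coefficient of L_p(f, α, T) ∈ ℤ_p⟦T⟧ is a p-adic unit (L_p ∉ pΛ). Class-wide OPEN (Greenberg LNM
1716 Conj. 1.11 is stated on the algebraic side; under the main conjecture the two agree); per pair
a finite exact modular-symbol computation — RECORDS OF RECORD (REF-KOLY-VERDICT v5-1 GAP 1 /
residual R1, corrected here): book230 0 open cells ‖ 250 (26 Greenberg–Vatsal transports +
unit-coefficient certificates), N3 two-engine μ-certificates (31 instances), KOLY-MEMO v1.7.1 twist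
face 8/8 (kit j246463), U1 21/21 CM pairs; the class-wide census counts 790 X9 pairs at N < 5·10⁵
(624 of them 5S4, the rest 5Ns/7Ns — KOLY-MEMO l.115 / X9-IMAGE-SHAPE-G3 §3b; 91 with a
good-ordinary CM elliptic-curve partner over ℚ; 155682e1 and 229842h1, both N > 30 000, have no
congruent partner) — no exception wherever a certificate was run, and NO class-wide 790-pair
certification on record (the earlier «all 790 pairs of conductor ≤ 30 000» wording is withdrawn).
SPLIT D1 (rev 4): ⟸ MuZeroCMCurves ∧ AnalyticMuZeroX9NoCMPartner ∧ MuS -/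
@[route_item "route-BirchSwinnertonDyer-SmallImageMuTransfer", crux]
def AnalyticMuZeroX9 : Prop :=
  Summit.BirchSwinnertonDyer.BirchSwinnertonDyer.Rank1Residual.AnalyticMuZeroOnClassX9

-- parent: AnalyticMuZeroX9 · child (gen 1)
/--     item stmt-BirchSwinnertonDyer-19234 · crux · rank 301 · open
    parent: AnalyticMuZeroX9 · by planner
    why it might fail: mu > 0 for a single CM twist (e.g. y^2 = x^3 - Dx at p = 5) refutes it and Greenberg 1.11; the only proved method (Sinnott/Gillard independence) is capped at one-prime towers, the cyclotomic pushforward couples the two variables.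
    sources: Greenberg1999 Conj. 1.11, Rubin1991 Thm. 12.3, doi:10.1016/0022-314X(87)90013-8 (Schneps 1987) p.20, EmertonPollackWeston2006 Thm. 1 (arXiv:math/0404484 p.2), U1-CM-TRANSFER.md §0 (L2), §4 (pub-bsdres/b2b-bsdres-lit, 2026-08-18)
[crux] Greenberg's μ = 0 (Conj. 1.11) for the CM elliptic curves over ℚ whose j-invariant lies in
the tree's `maximalCMJInvariants` — the 9 j-invariants with CM by a MAXIMAL order of class number
one (`card_maximalCMJInvariants`); the 4 class-number-one NON-maximal orders (discriminants −12,
−16, −27, −28) are reached from the maximal-order curve by an isogeny of degree 2 or 3, prime to p ≥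
5, which preserves A[p], so as the CM anchor of split D1 the statement still serves all 13 CM
j-invariants over ℚ (residual R4 of REF-KOLY-VERDICT v10, corrected here: the earlier «13
class-number-one CM invariants» wording described the reach, not the quantifier) — at every good
ordinary (= split) prime p ≥ 5 with A[p] irreducible, in the cell's ϖ-normalisation: some
coefficient of ϖ·L_p(f_A, α) is a p-adic unit. Equivalent (Rubin 1991 Thm 12.3 + Greenberg–Vatsal
2000 `mu_eq_zero_iff_hasUnitContent`) to μ^alg(A/ℚ_∞) = 0; per curve a finite certificate (U1
2026-08-18: 21/21 CM pairs, exact modular symbols); class-wide = vanishing of μ of the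
NORM-PUSHFORWARD to the cyclotomic line of Katz's two-variable measure on the ψ_A-branch — not in
print (Gillard 1985 / Schneps 1987 / Oukhaba–Viguié 2016: -/
@[route_item "route-BirchSwinnertonDyer-SmallImageMuTransfer", crux]
def MuZeroCMCurves : Prop :=
  ∀ (A : WeierstrassCurve ℚ) [A.IsElliptic] [A.IsGloballyMinimal] (p : ℕ) [Fact p.Prime], 5 ≤ p → A.j ∈ Literature.NumberTheory.EllipticCurves.maximalCMJInvariants → A.HasGoodReductionAtPrime p → ¬ (p : ℤ) ∣ A.frobeniusTrace p → A.HasIrreducibleModPGaloisRep p → ∀ [NeZero (A.conductorNorm ℤ)] (fA : CuspForm (CongruenceSubgroup.Gamma0 (A.conductorNorm ℤ)) 2), Literature.NumberTheory.EllipticCurves.ModularForms.IsNewformOf A fA → ∀ (ϖ : ℚ), (ϖ : ℝ) * A.realPeriodRat = Literature.NumberTheory.EllipticCurves.ModularForms.plusPeriod fA → ∃ n : ℕ, ‖PowerSeries.coeff n (PowerSeries.C (ϖ : ℚ_[p]) * Literature.NumberTheory.EllipticCurves.padicLFunction fA (Literature.NumberTheory.EllipticCurves.unitRoot A p : ℚ_[p]))‖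 = 1

-- parent: AnalyticMuZeroX9 · child (gen 1)
/--     item stmt-BirchSwinnertonDyer-19235 · crux · rank 302 · open
    parent: AnalyticMuZeroX9 · by planner
    why it might fail: it is Greenberg's conjecture on 699/790 of the X9 census mass with no structure beyond EPW's per-rho-bar rigidity; one mu > 0 at an octahedral (5S4) pair refutes it.
    sources: Greenberg1999 Conj. 1.11, EmertonPollackWeston2006 Thm. 1, X9-CENSUS-G38.md §4 (b2b-bsdres-x9 g38, 04ddd49fa8a87899)
[crux] The analytic mu = 0 certificate on the X9 pairs WITHOUT a CM elliptic-curve partner (no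
globally minimal CM curve A/Q, good ordinary at p, with A[p] = W[p] equivariantly): type 5S4
(624/790 census pairs), split-dihedral with M real (2), h_M > 1 or character ratio of order > 2
(73). The honest remainder of the split; handles today = per-rho-bar certificates (EPW Thm 1) only. -/
@[route_item "route-BirchSwinnertonDyer-SmallImageMuTransfer", crux]
def AnalyticMuZeroX9NoCMPartner : Prop :=
  ∀ (W : WeierstrassCurve ℚ) [W.IsElliptic] [W.IsGloballyMinimal] (p : ℕ) [Fact p.Prime] {N : ℕ} [NeZero N] (f : CuspForm (CongruenceSubgroup.Gamma0 N) 2), Summit.BirchSwinnertonDyer.BirchSwinnertonDyer.Rank1Residual.ClassX9 W p → ¬ (∃ (A : WeierstrassCurve ℚ) (_ : A.IsElliptic) (_ : A.IsGloballyMinimal), A.j ∈ Literature.NumberTheory.EllipticCurves.maximalCMJInvariants ∧ A.HasGoodReductionAtPrime p ∧ ¬ (p : ℤ) ∣ A.frobeniusTrace p ∧ ∃ e : WeierstrassCurve.geomTorsion A (p : ℤ) ≃+ WeierstrassCurve.geomTorsion W (p : ℤ), ∀ (σ : Field.absoluteGaloisGroup ℚ) (P : WeierstrassCurve.geomTorsion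 A (p : ℤ)), e (σ • P) = σ • e P) → Literature.NumberTheory.EllipticCurves.ModularForms.IsNewformOf W f → ∃ n : ℕ, ‖PowerSeries.coeff n (Literature.NumberTheory.EllipticCurves.padicLFunction f (Literature.NumberTheory.EllipticCurves.unitRoot W p : ℚ_[p]))‖ = 1

-- parent: AnalyticMuZeroX9 · child (gen 1)
/--     item stmt-BirchSwinnertonDyer-19236 · support · rank 303 · open
    parent: AnalyticMuZeroX9 · by planner
    sources: EmertonPollackWeston2006 Thm. 1, GreenbergVatsal2000 Rem. 3.4, Carayol1986
[support, cite-only] the three published inputs of the seam: EPW 2006 Thm 1 (analytic half,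
congruent good-ordinary curves), the period unit Omega_E = u * Omega^+_f with |u|_p = 1 at
irreducible p >= 5 (GV00 Rem. 3.4 + Manin constant; = conjunct A25 of PublishedInputsX9), Carayol's
level = conductor. -/
@[route_item "route-BirchSwinnertonDyer-SmallImageMuTransfer", crux]
def MuSplitInputs : Prop :=
  Literature.NumberTheory.EllipticCurves.EmertonPollackWeston2006.thm1_muAn_transfer_of_torsionIso ∧ Literature.NumberTheory.EllipticCurves.realPeriodRat_eq_unit_mul_plusPeriod ∧ (∀ (N : ℕ) [NeZero N], Literature.NumberTheory.EllipticCurves.ModularForms.IsNewformOf.level_eq_conductorNorm (N := N))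

-- parent: AnalyticMuZeroX9 · glue (gen 1)
/--     item stmt-BirchSwinnertonDyer-19237 · support · rank 304 · closed · proved by Summit.BirchSwinnertonDyer.BirchSwinnertonDyer.Theorems.smallImageMuTransfer_AnalyticMuZeroX9Split_proof (prover)
    parent: AnalyticMuZeroX9 · GLUE: children ⟹ parent · by planner
by cases on a good-ordinary CM elliptic partner A with A[p] = W[p]: with a partner, MuZeroCMCurves
at A + EPW 2006 Thm 1 (analytic mu transfer along the torsion isomorphism) + the period unit A25
(removes varpi) + Carayol (newform level = conductor); without one, AnalyticMuZeroX9NoCMPartner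
verbatim. Proof READY: plan/k6/split/SplitMu.lean::analyticMuZeroX9_of_split (sha16
4ce041deed07a876, farm rc 0, 0 sorry, axioms propext/Classical.choice/Quot.sound) - a prover ports
it into Theorems/ to close this glue item -/
@[route_item "route-BirchSwinnertonDyer-SmallImageMuTransfer"]
def AnalyticMuZeroX9Split : Prop :=
  MuZeroCMCurves → AnalyticMuZeroX9NoCMPartner → MuSplitInputs → AnalyticMuZeroX9

-- `AnalyticMuZeroX9Split` holds: proved by `Summit.BirchSwinnertonDyer.BirchSwinnertonDyer.Theorems.smallImageMuTransfer_AnalyticMuZeroX9Split_proof` (its module imports this route file, so no `_holds` link can be stated here).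

/-- item stmt-BirchSwinnertonDyer-19631 · crux · rank 4 · open · by planner
why it might fail: Schneider's conjecture is open in every rank ≥ 1; a single rank-1 X9 curve whose generator has canonical 5-adic (or 7-adic) height zero — equivalently [T¹]L_p(f, α) = 0 — refutes the crux (none among the rank-1 X9 pairs sampled by the cell, but the class is infinite).
sources: Schneider1985, PerrinRiou1987, MazurSteinTate2006, SteinWuthrich2013, Wuthrich2014
[crux] Schneider's conjecture on the rank-1 part of X9: for every X9 pair (E, p) of analytic rank 1
and every CANONICAL p-adic height datum Dh on E at p, the cyclotomic p-adic height pairing is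
non-degenerate (Reg_p ≠ 0) — the binder hC3 of the kernel bridge; by Perrin-Riou's p-adic
Gross–Zagier it is equivalent to ord_T L_p(f, α, T) = 1 on these pairs. [difficulty: L] -/
@[route_item "route-BirchSwinnertonDyer-SmallImageMuTransfer", crux]
def SchneiderX9RankOne : Prop :=
  ∀ (W : WeierstrassCurve ℚ) [W.IsElliptic] [W.IsGloballyMinimal] (p : ℕ) [Fact p.Prime], Summit.BirchSwinnertonDyer.BirchSwinnertonDyer.Rank1Residual.ClassX9 W p → W.analyticRank = 1 → ∀ Dh : WeierstrassCurve.PAdicHeightData W p, Dh.IsCanonical → WeierstrassCurve.SchneiderConjecture Dh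

/-- item stmt-BirchSwinnertonDyer-19266 · aside · rank 8 · open · by planner
sources: BCDTJAMS2001
[support] modularity of E/ℚ as parametrisation data (Breuil–Conrad–Diamond–Taylor 2001 Thm A), BY
NAME — conjunct of OrdPublishedInputsAtTwo (19149; Literature.Uncategorized.OrdPublishedInputsAtTwo
l.26); same content, filed so the head constant is item-stated (#15c one rule; cite_only dep) -/
@[route_item "route-BirchSwinnertonDyer-SmallImageMuTransfer", crux]
def ModularParametrizationSupply : Prop :=
  Literature.NumberTheory.EllipticCurves.ModularForms.nonempty_modularParametrizationData

/-- item stmt-BirchSwinnertonDyer-19273 · aside · rank 8 · open · by planner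
sources: BCDTJAMS2001, Wiles1995
[support] entire continuation of L(E/ℚ, s) (modularity: Breuil–Conrad–Diamond–Taylor 2001 Thm A +
Hecke/Shimura), BY NAME — conjunct of MultConversePublishedInputsAtTwo (19185); same content, filed
so the head constant is item-stated (#15c one rule; cite_only dep) -/
@[route_item "route-BirchSwinnertonDyer-SmallImageMuTransfer"]
def EntireLFunctionRat : Prop :=
  WeierstrassCurve.hasEntireLFunction_rat

/-- item stmt-BirchSwinnertonDyer-19921 · aside · rank 8 · open · by operator
sources: GrossZagier1986, KolyvaginEulerSystems1990, Darmon2004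
[support] The one PUBLISHED input the halves-glue consumes: Gross–Zagier–Kolyvagin, rank = analytic
rank for analytic rank ≤ 1 with Ш finite (tree named fact
rank_eq_analyticRank_of_analyticRank_le_one; used by bsdp_of_missingPPartAt to turn Miller's last
clause into BSD(E,2)). Carried as a displayed PUB hypothesis; never counted as progress. The further
PRINT of the roads to the two halves (Greenberg Thm-4.1 analogues at a multiplicative prime
thm41Analogue_charValue_rankZero_numberField_anyPrime / …_split_baseChange_anyPrime, modularity) and
the referee-passed MEMO inputs (Kato ⊗ℚ at a multiplicative 2:
X5.O1.KatoMultiplicativeDivisibilityRat W 2, HOME mult/PROOF-MULT.md RC-2; Greenberg–Stevens at 2: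
greenberg_stevens W 2, mult/PROOF-GS2.md RC-4) enter the LINES under the halves (bridge
multiplicativeRankZeroAtTwo_of_muRoad, p409679), not this glue. -/
@[route_item "route-BirchSwinnertonDyer-SmallImageMuTransfer", crux]
def RankEqAnalyticRankLeOne : Prop :=
  Literature.NumberTheory.EllipticCurves.rank_eq_analyticRank_of_analyticRank_le_one

/-- item stmt-BirchSwinnertonDyer-19464 · aside · rank 9 · open · by planner
sources: EmertonPollackWeston2006
[aside] Emerton–Pollack–Weston 2006 Thm 1 (analytic half; Invent. Math. 163, §1 p. 524 and Thm
3.3.1/§3.4): for p-congruent good-ordinary elliptic curves E₁[p] ≃ E₂[p] (E_i[p] irreducible, p ≥ 5)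
μ(L_p(E₁)) = 0 ⟺ μ(L_p(E₂)) = 0 in the ϖ-normalisation — the transport used by the landed seam
smallImageMuTransfer_AnalyticMuZeroX9Split_proof (p418273). Banked context (D-0019 aside): never
staffed, not progress; filed so the cite-only constant, which sits inside the layer-2 cite-only
inputs item(s) MuSplitInputs (stmt-BirchSwinnertonDyer-19236) (a split child cannot be split again —
two layers only), is item-stated BY NAME (readiness rule 2026-08-15 / gate5 #15c; K3 precedent
route-BirchSwinnertonDyer-SignedLowerHalves rev 4). No crux statement / closes / tribunal /
tribunal_fit change. -/
@[route_item "route-BirchSwinnertonDyer-SmallImageMuTransfer"]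
def EPWMuAnTransfer : Prop :=
  Literature.NumberTheory.EllipticCurves.EmertonPollackWeston2006.thm1_muAn_transfer_of_torsionIso

/-- item stmt-BirchSwinnertonDyer-19465 · aside · rank 9 · open · by planner
sources: GreenbergVatsal2000
[aside] Greenberg–Vatsal 2000 Thm 1.4 (Invent. Math. 142, p. 20): for p-congruent good-ordinary E₁,
E₂ with E_i[p] irreducible, if μ vanishes on both sides for E₁ then the cyclotomic main conjecture
for E₁ implies it for E₂ — the transport used by the landed CM helper
Rank1Residual.smallImageMuTransfer_stub_cm_of_rubin_of_gv (p417975). Banked context (D-0019 aside):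
never staffed, not progress; filed so the cite-only constant, which sits inside the layer-2
cite-only inputs item(s) MuTransferInputs (stmt-BirchSwinnertonDyer-19277) (a split child cannot be
split again — two layers only), is item-stated BY NAME (readiness rule 2026-08-15 / gate5 #15c; K3
precedent route-BirchSwinnertonDyer-SignedLowerHalves rev 4). No crux statement / closes / tribunal
/ tribunal_fit change. -/
@[route_item "route-BirchSwinnertonDyer-SmallImageMuTransfer"]
def GreenbergVatsalMainConjectureTransfer : Prop :=
  Literature.NumberTheory.EllipticCurves.GreenbergVatsal2000.thm14_mainConjecture_transfer_of_torsionIso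

/-- item stmt-BirchSwinnertonDyer-19466 · aside · rank 9 · open · by planner
sources: Rubin1991, deShalit1987
[aside] Rubin 1991 Thm 12.3 (Invent. Math. 103; with de Shalit 1987 II.4–II.6): the cyclotomic main
conjecture for CM elliptic curves over ℚ at good ordinary (split) p, characteristic ideal = (L_p) —
the CM input of the landed helper smallImageMuTransfer_stub_cm_of_rubin_of_gv (p417975). Banked
context (D-0019 aside): never staffed, not progress; filed so the cite-only constant, which sits
inside the layer-2 cite-only inputs item(s) MuTransferInputs (stmt-BirchSwinnertonDyer-19277) (a
split child cannot be split again — two layers only), is item-stated BY NAME (readiness rule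
2026-08-15 / gate5 #15c; K3 precedent route-BirchSwinnertonDyer-SignedLowerHalves rev 4). No crux
statement / closes / tribunal / tribunal_fit change. -/
@[route_item "route-BirchSwinnertonDyer-SmallImageMuTransfer"]
def RubinCMMainConjecture : Prop :=
  Literature.NumberTheory.EllipticCurves.Rubin1991.thm123_charIdeal_eq_padicLFunction_of_cm

/-- item stmt-BirchSwinnertonDyer-19467 · aside · rank 9 · open · by planner
sources: Carayol1986, DiamondShurman2005
[aside] Carayol 1986 (Ann. Sci. ÉNS 19; Diamond–Shurman Thm 8.8.1): if f ∈ S₂(Γ₀(N)) is the newform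
of E then N = N_E — the ∀-closure over the level N of the tree's named fact
`IsNewformOf.level_eq_conductorNorm` (its N is a section variable), verbatim the last conjunct of
both layer-2 inputs items. Banked context (D-0019 aside): never staffed, not progress; filed so the
cite-only constant, which sits inside the layer-2 cite-only inputs item(s) MuTransferInputs
(stmt-BirchSwinnertonDyer-19277) and MuSplitInputs (stmt-BirchSwinnertonDyer-19236) (a split child
cannot be split again — two layers only), is item-stated BY NAME (readiness rule 2026-08-15 / gate5
#15c; K3 precedent route-BirchSwinnertonDyer-SignedLowerHalves rev 4). No crux statement / closes /
tribunal / tribunal_fit change. -/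
@[route_item "route-BirchSwinnertonDyer-SmallImageMuTransfer"]
def NewformLevelEqConductor : Prop :=
  ∀ (N : ℕ) [NeZero N], Literature.NumberTheory.EllipticCurves.ModularForms.IsNewformOf.level_eq_conductorNorm (N := N)

/-- item stmt-BirchSwinnertonDyer-19468 · aside · rank 9 · open · by planner
sources: Schneider1985, BalakrishnanMullerStein2015
[aside] Schneider 1985 Thm 2′ (p. 342) / Thm 7 (p. 371) with Perrin-Riou 1992 §3.4.2–3.4.3
(transcribed from Balakrishnan–Müller–Stein 2015 Thm 1.7): ord_T of a characteristic generator =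
rank and its leading term up to a unit, given Schneider's non-degeneracy — conjunct 4 of
PublishedInputsX9, inside the split child IwasawaLeadingTermFactsX9; item-stated BY NAME here
because split.k_max = 7 from this seat forced two facts into one child. Banked context (aside):
never staffed; no crux statement / closes / tribunal change. -/
@[route_item "route-BirchSwinnertonDyer-SmallImageMuTransfer"]
def SchneiderOrderCharGenerator : Prop :=
  Literature.NumberTheory.EllipticCurves.Schneider1985_order_charGenerator

/-- item stmt-BirchSwinnertonDyer-19469 · aside · rank 9 · open · by planner
sources: PerrinRiou1987
[aside] Perrin-Riou 1987 Thm 1.3, (1.1) and §1.4 Cor. 1.8 (p-adic Gross–Zagier): rank-one leading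
terms — conjunct 5 of PublishedInputsX9, inside the split child IwasawaLeadingTermFactsX9;
item-stated BY NAME here because split.k_max = 7 from this seat forced two facts into one child.
Banked context (aside): never staffed; no crux statement / closes / tribunal change. -/
@[route_item "route-BirchSwinnertonDyer-SmallImageMuTransfer", crux]
def PerrinRiouRankOneLeadingTerms : Prop :=
  Literature.NumberTheory.EllipticCurves.perrinRiou_rankOne_leadingTerms

/-- item stmt-BirchSwinnertonDyer-19632 · support · rank 9 · SPLIT (gen 1) into BCSCharIdealEqPadicLFunction, GreenbergCharValueRankZero, RealPeriodUnitPlusPeriod, IwasawaLeadingTermFactsX9, ModularParametrizationSupply, EntireLFunctionRat, RankEqAnalyticRankLeOne + glue PublishedInputsX9OfParts · direct attempts still welcome (low priority) · by planner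
sources: BurungaleCastellaSkinner2025, GreenbergLNM1716, Schneider1985, PerrinRiou1987, Wuthrich2014, BCDT2001
[support] The eight PUBLISHED named facts the kernel bridge `bsdpOnClassX9_of_katoMuTransfer`
consumes, as one conjunction of the tree's cited Props: BCS 2025 Thm 1.1.2 (a) (characteristic ideal
= (L_p) given μ = 0 and Kato), Greenberg 1999 Thm 4.1 (rank-0 Euler characteristic), the real period
vs plus period unit relation, Schneider 1985 (order of the characteristic power series), Perrin-Riou
1987 rank-one leading terms, modularity (parametrisation), entire L-function over ℚ, rank = analytic
rank ≤ 1 (Gross–Zagier–Kolyvagin). Provable-now means: discharge conjunct by conjunct as the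
`_holds` theorems land; the non-`_odd` Schneider/Perrin-Riou facts are the bridge's exact binder
types. [difficulty: provable-now] -/
@[route_item "route-BirchSwinnertonDyer-SmallImageMuTransfer", crux]
def PublishedInputsX9 : Prop :=
  Literature.NumberTheory.EllipticCurves.burungale_castella_skinner_charIdeal_eq_padicLFunction ∧ Literature.NumberTheory.EllipticCurves.greenberg_charValue_rankZero ∧ Literature.NumberTheory.EllipticCurves.realPeriodRat_eq_unit_mul_plusPeriod ∧ Literature.NumberTheory.EllipticCurves.Schneider1985_order_charGenerator ∧ Literature.NumberTheory.EllipticCurves.perrinRiou_rankOne_leadingTerms ∧ Literature.NumberTheory.EllipticCurves.ModularForms.nonempty_modularParametrizationData ∧ WeierstrassCurve.hasEntireLFunction_rat ∧ Literature.NumberTheory.EllipticCurves.rank_eq_analyticRank_of_analyticRank_le_one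

-- parent: PublishedInputsX9 · child (gen 1)
/--     item stmt-BirchSwinnertonDyer-19459 · support · rank 901 · open
    parent: PublishedInputsX9 · by planner
    sources: BurungaleCastellaSkinner2025
[support, cite-only] Burungale–Castella–Skinner 2025 Thm 1.1.2 (a) (arXiv:2405.00270v2 p. 2): for
E/ℚ, p ≥ 5 good ordinary with E[p] irreducible, the cyclotomic characteristic ideal equals (L_p(E))
in Λ ⊗ ℚ_p (integrally given μ = 0 on both sides) — conjunct of PublishedInputsX9
(stmt-BirchSwinnertonDyer-19632, text FROZEN REF v8-3), BY NAME; same content, filed as a split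
child so the head constant is item-stated (readiness rule 2026-08-15 / gate5 #15c: a cite_only dep
must be declared by the route); no crux statement / closes / tribunal change; never staffed for
proof (cite-only, to be HELD), closes only when the named fact becomes a theorem -/
@[route_item "route-BirchSwinnertonDyer-SmallImageMuTransfer", crux]
def BCSCharIdealEqPadicLFunction : Prop :=
  Literature.NumberTheory.EllipticCurves.burungale_castella_skinner_charIdeal_eq_padicLFunction

-- parent: PublishedInputsX9 · child (gen 1)
/--     item stmt-BirchSwinnertonDyer-19460 · support · rank 902 · closed · proved by Summit.BirchSwinnertonDyer.BirchSwinnertonDyer.Theorems.InputsDeskTwoTurnkey.smallImageMuTransfer_greenbergCharValueRankZero (prover)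
    parent: PublishedInputsX9 · by planner
    sources: GreenbergLNM1716
[support, cite-only] Greenberg LNM 1716 Thm 4.1 (p. 102; held copy
book:coatesnd-arithmetic-theory-elliptic-curves chunk p0091): the rank-0 Euler-characteristic
formula f_E(0) ~ #Sel · ∏c_v · #Ẽ(𝔽_p)² / #E(ℚ)_tors² at good ordinary p — conjunct of
PublishedInputsX9 (stmt-BirchSwinnertonDyer-19632, text FROZEN REF v8-3), BY NAME; same content,
filed as a split child so the head constant is item-stated (readiness rule 2026-08-15 / gate5 #15c:
a cite_only dep must be declared by the route); no crux statement / closes / tribunal change; never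
staffed for proof (cite-only, to be HELD), closes only when the named fact becomes a theorem -/
@[route_item "route-BirchSwinnertonDyer-SmallImageMuTransfer", crux]
def GreenbergCharValueRankZero : Prop :=
  Literature.NumberTheory.EllipticCurves.greenberg_charValue_rankZero

-- `GreenbergCharValueRankZero` holds: proved by `Summit.BirchSwinnertonDyer.BirchSwinnertonDyer.Theorems.InputsDeskTwoTurnkey.smallImageMuTransfer_greenbergCharValueRankZero` (its module imports this route file, so no `_holds` link can be stated here).

-- parent: PublishedInputsX9 · child (gen 1)
/--     item stmt-BirchSwinnertonDyer-19290 · support · rank 903 · closed · proved by Summit.BirchSwinnertonDyer.BirchSwinnertonDyer.Theorems.SignedLowerHalves.RealPeriodUnitPlusPeriod_proof (prover)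
    parent: PublishedInputsX9 · by operator
    sources: GreenbergVatsal2000, AbbesUllmo1996
[support] Néron period vs. plus period of the newform: Ω_E = u · Ω⁺_f with u a p-adic unit, p ≥ 5
(Manin constant: Mazur 1978 Cor. 4.1, Edixhoven 1991 Prop. 2, Abbes–Ullmo 1996 Thm. A;
Greenberg–Vatsal 2000 Rem. 3.4) — conjunct of PublishedSignedInputs
(stmt-BirchSwinnertonDyer-19005), BY NAME; same content, filed as a split child so the head constant
is item-stated (gate5 #15c one rule; readiness rule 2026-08-15: cite_only dep declared by the
route); no statement / closes / tribunal change -/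
@[route_item "route-BirchSwinnertonDyer-SmallImageMuTransfer", crux]
def RealPeriodUnitPlusPeriod : Prop :=
  Literature.NumberTheory.EllipticCurves.realPeriodRat_eq_unit_mul_plusPeriod

/-- `RealPeriodUnitPlusPeriod` holds: proved by `Summit.BirchSwinnertonDyer.BirchSwinnertonDyer.Theorems.SignedLowerHalves.RealPeriodUnitPlusPeriod_proof`. -/
theorem RealPeriodUnitPlusPeriod_holds : RealPeriodUnitPlusPeriod := _root_.Summit.BirchSwinnertonDyer.BirchSwinnertonDyer.Theorems.SignedLowerHalves.RealPeriodUnitPlusPeriod_proof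

-- parent: PublishedInputsX9 · child (gen 1)
/--     item stmt-BirchSwinnertonDyer-19461 · support · rank 904 · open
    parent: PublishedInputsX9 · by planner
    sources: Schneider1985, PerrinRiou1987, BalakrishnanMullerStein2015
[support, cite-only] the two Iwasawa leading-term facts of PublishedInputsX9 as ONE child
(split.k_max = 7 from this seat): Schneider 1985 Thm 2′/Thm 7 (order and leading term of a
characteristic generator, transcribed from Balakrishnan–Müller–Stein 2015 Thm 1.7) ∧ Perrin-Riou
1987 Thm 1.3/Cor. 1.8 (rank-one leading terms); its two constants are item-stated BY NAME as the
asides SchneiderOrderCharGenerator / PerrinRiouRankOneLeadingTerms — conjunct of PublishedInputsX9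
(stmt-BirchSwinnertonDyer-19632, text FROZEN REF v8-3), BY NAME; same content, filed as a split
child so the head constant is item-stated (readiness rule 2026-08-15 / gate5 #15c: a cite_only dep
must be declared by the route); no crux statement / closes / tribunal change; never staffed for
proof (cite-only, to be HELD), closes only when the named fact becomes a theorem -/
@[route_item "route-BirchSwinnertonDyer-SmallImageMuTransfer", crux]
def IwasawaLeadingTermFactsX9 : Prop :=
  Literature.NumberTheory.EllipticCurves.Schneider1985_order_charGenerator ∧ Literature.NumberTheory.EllipticCurves.perrinRiou_rankOne_leadingTerms

-- parent: PublishedInputsX9 · glue (gen 1)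
/--     item stmt-BirchSwinnertonDyer-19462 · support · rank 908 · closed · proved by Summit.BirchSwinnertonDyer.BirchSwinnertonDyer.Theorems.smallImageMuTransfer_PublishedInputsX9OfParts_proof (prover)
    parent: PublishedInputsX9 · GLUE: children ⟹ parent · by planner
children = the cite-only conjuncts of PublishedInputsX9 BY NAME, in conjunct order (BCS 1.1.2(a),
Greenberg 4.1, period unit A25, [Schneider 1985 ∧ Perrin-Riou 1987 as ONE child
IwasawaLeadingTermFactsX9 — split.k_max = 7], modular parametrisation, entire L-function, rank =
analytic rank ≤ 1); glue PublishedInputsX9OfParts : C1 → … → C7 → PublishedInputsX9 is the anonymous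
constructor splitting the fourth hypothesis (planner folder staffable/AliasSketch.lean
publishedInputsX9OfPartsB_holds, farm rc 0) — a one-line port for any idle prover -/
@[route_item "route-BirchSwinnertonDyer-SmallImageMuTransfer"]
def PublishedInputsX9OfParts : Prop :=
  BCSCharIdealEqPadicLFunction → GreenbergCharValueRankZero → RealPeriodUnitPlusPeriod → IwasawaLeadingTermFactsX9 → ModularParametrizationSupply → EntireLFunctionRat → RankEqAnalyticRankLeOne → PublishedInputsX9

-- `PublishedInputsX9OfParts` holds: proved by `Summit.BirchSwinnertonDyer.BirchSwinnertonDyer.Theorems.smallImageMuTransfer_PublishedInputsX9OfParts_proof` (its module imports this route file, so no `_holds` link can be stated here).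

/-- item stmt-BirchSwinnertonDyer-19842 · support · rank 9 · closed · proved by Summit.BirchSwinnertonDyer.BirchSwinnertonDyer.Theorems.smallImageMuTransfer_MuTransferX9Core_proof (prover) · by planner
why it might fail: None left: CLOSED `proved` p476037 (axioms standard). Of its three hypotheses F2 (p480014/p480061) and F3 (p475389/p477977) are theorems and F1 is the published input (aside 19843) — see 19276.
sources: Kato2004Asterisque Thm. 12.5, 12.6 (p. 222), Ex. 13.3, §13.8 (pp. 228–229), (14.9.3), (17.13.1), §17.13, NeukirchSchmidtWingberg2008 (8.6.10); MilneADT2006 I Thm 4.10, pub-bsd-smallim/koly/MU-TRANSFER-PROOF.md §§1–6 (Theorem A, Cor. B); KOLY-MEMO v1.6 Thm 5.7.1, skeleton v6c a17c2b579b8fb484 (k6-c2 g3, 2026-08-26T20:13Z) on stmt-BirchSwinnertonDyer-19276; p452034 Theorems …X9CoreAssemblyOdd; p465845 SelmerDual.stub_selmerDualOdd_holds, p476037 `Theorems.smallImageMuTransfer_MuTransferX9Core_proof` (k6-c2 g4); stubs p465845 / p474398; composition p470966, F2: p480014 `UniversalNorms.stub_red`, p479589, p477776 (aside 19844 CLOSED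 p480061); F3: p475389 `poitouTate_sum_localTatePairing_eq_zero_holds` (aside 19845 CLOSED p477977)
[support] CLOSED `proved` (k6-c2 g4 p476037, `Theorems.smallImageMuTransfer_MuTransferX9Core_proof`,
axioms std): CONDITIONAL CORE of the deciding child MuTransferX9 (stmt-19276) — Kato's μ-transfer
without τ on class X9 (KOLY-MEMO Thm 5.7.1; MU-TRANSFER-PROOF Thm A) with hypotheses EXACTLY F1
`Kato2004.exists_divisibilityInputs_fineQuotient_zeta` (Kato Thm 12.5/12.6 + (14.9.3)/(17.13.1) +
span clause; aside KatoZetaFineQuotientInputs, OPEN = the rung's published input) → F2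
`Kato2004.mem_pSmul_of_red_eq_zero` (Kato §13.8; aside KatoReductionModPKernel CLOSED p480061: a
THEOREM via the weak Lemma 8.5 (2), `UniversalNorms.stub_red` p480014) → F3
`GaloisCohomology.poitouTate_sum_localTatePairing_eq_zero ℚ` (aside PoitouTateSumLocalPairingsRat
CLOSED p477977: a THEOREM for every number field, p475389) → <MuTransferX9 VERBATIM>. Proof =
`…_of_stepsTwoFourOdd` (p470966) with Tate's local Euler–Poincaré characteristic (tree theorem) and
the two skeleton-v6 stubs, theorems p465845 / p474398. Hence
`smallImageMuTransfer_MuTransferX9_of_fine_red F1 UniversalNorms.stub_red : MuTransferX9` (p478541)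
⇒ 19276 is kernel-checked modulo F1 ALONE; it closes by one line once F1 has a `_holds`. -/
@[route_item "route-BirchSwinnertonDyer-SmallImageMuTransfer"]
def MuTransferX9Core : Prop :=
  Literature.NumberTheory.EllipticCurves.Kato2004.exists_divisibilityInputs_fineQuotient_zeta → Literature.NumberTheory.EllipticCurves.Kato2004.mem_pSmul_of_red_eq_zero → Literature.NumberTheory.GaloisCohomology.poitouTate_sum_localTatePairing_eq_zero ℚ → ∀ (W : WeierstrassCurve ℚ) [W.IsElliptic] [W.IsGloballyMinimal] (p : ℕ) [Fact p.Prime] {N : ℕ} [NeZero N] (f : CuspForm (CongruenceSubgroup.Gamma0 N) 2), Summit.BirchSwinnertonDyer.BirchSwinnertonDyer.Rank1Residual.ClassX9 W p → Literature.NumberTheory.EllipticCurves.ModularForms.IsNewformOf W f → (∃ n : ℕ, ‖PowerSeries.coeff n (Literature.NumberTheory.EllipticCurves.padicLFunction f (Literature.NumberTheory.EllipticCurves.unitRoot W p : ℚ_[p]))‖ = 1) → ∀ (κ : Literature.NumberTheory.EllipticCurves.ZpExtension ℚ p) (γ : Field.absoluteGaloisGroup ℚ), κ.IsCyclotomic →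 κ.IsTopGenerator γ → Literature.NumberTheory.EllipticCurves.IsCyclotomicVariable p γ → ∀ D : W.SelmerDualData κ γ, D.mu = 0

-- `MuTransferX9Core` holds: proved by `Summit.BirchSwinnertonDyer.BirchSwinnertonDyer.Theorems.smallImageMuTransfer_MuTransferX9Core_proof` (its module imports this route file, so no `_holds` link can be stated here).

/-- item stmt-BirchSwinnertonDyer-19843 · aside · rank 9 · open · by planner
sources: Kato2004Asterisque Thm. 12.5, Thm. 12.6 (p. 222), Ex. 13.3 (p. 225), (14.9.3) (p. 240), (17.13.1) (p. 279)
[aside] by-name alias (never staffed; readiness rule «head constant item-stated») of the NAMED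
LITERATURE FACT `Kato2004.exists_divisibilityInputs_fineQuotient_zeta`
(Literature/NumberTheory/EllipticCurves/Kato2004/EulerSystemClasses.lean): Kato 2004 Thm 12.5/12.6 +
Ex. 13.3 — for E/ℚ, p odd good ordinary, newform f, cyclotomic (κ,γ) and Kato's 𝐇¹_Γ(T_pE) datum I,
a DivisibilityInputs package K whose torsion quotient is the fine Selmer dual X₀ via
(14.9.3)/(17.13.1) and whose zeta elements span the image of the Euler-system classes. Registered
PUB stub `stub_inputsX9` of skeleton v6c verbatim. Hypothesis 1 of MuTransferX9Core. -/
@[route_item "route-BirchSwinnertonDyer-SmallImageMuTransfer"]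
def KatoZetaFineQuotientInputs : Prop :=
  Literature.NumberTheory.EllipticCurves.Kato2004.exists_divisibilityInputs_fineQuotient_zeta

/-- item stmt-BirchSwinnertonDyer-19844 · aside · rank 9 · closed · proved by Summit.BirchSwinnertonDyer.BirchSwinnertonDyer.Theorems.smallImageMuTransfer_KatoReductionModPKernel_proof (prover) · by planner
sources: Kato2004Asterisque §13.8 (pp. 228–229), Lemma 8.5 (2)
[aside] by-name alias (never staffed) of the NAMED LITERATURE FACT
`Kato2004.mem_pSmul_of_red_eq_zero`
(Literature/NumberTheory/EllipticCurves/Kato2004/IwasawaH1Reduction.lean): Kato 2004 §13.8 (pp.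
228–229) — an element of Kato's 𝐇¹_Γ(T_pE) whose reduction mod p vanishes lies in p·𝐇¹
(continuous-cochain sequence of 0 → T → T → E[p] → 0 + Mittag-Leffler + Lemma 8.5 (2)); k6-c2 g3
rates it L-sized and provable in-tree. First conjunct of the registered PUB stub `stub_factsX9`
(v6c). Hypothesis 2 of MuTransferX9Core. -/
@[route_item "route-BirchSwinnertonDyer-SmallImageMuTransfer"]
def KatoReductionModPKernel : Prop :=
  Literature.NumberTheory.EllipticCurves.Kato2004.mem_pSmul_of_red_eq_zero

-- `KatoReductionModPKernel` holds: proved by `Summit.BirchSwinnertonDyer.BirchSwinnertonDyer.Theorems.smallImageMuTransfer_KatoReductionModPKernel_proof` (its module imports this route file, so no `_holds` link can be stated here).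

/-- item stmt-BirchSwinnertonDyer-19845 · aside · rank 9 · closed · proved by Summit.BirchSwinnertonDyer.BirchSwinnertonDyer.Theorems.smallImageMuTransfer_PoitouTateSumLocalPairingsRat_proof (prover) · by planner
sources: NeukirchSchmidtWingberg2008 (8.6.10), MilneADT2006 I Thm 4.10, I §2 Thm 2.8
[aside] by-name alias (never staffed) of the NAMED LITERATURE FACT
`GaloisCohomology.poitouTate_sum_localTatePairing_eq_zero ℚ`
(Literature/NumberTheory/GaloisCohomology/PoitouTate.lean): the Poitou–Tate sum formula over ℚ — for
a finite Galois module M and global classes x ∈ H¹(ℚ,M), y ∈ H¹(ℚ,M^*), the sum over all places of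
the local Tate pairings ⟨x_v, y_v⟩_v vanishes (NSW (8.6.10); Milne ADT I Thm 4.10). Second conjunct
of the registered PUB stub `stub_factsX9` (v6c); the third conjunct (Tate local EPC) is the tree
theorem `GaloisImage.EP.forall_localEulerPoincareCharacteristic_adicCompletion ℚ`. Hypothesis 3 of
MuTransferX9Core. -/
@[route_item "route-BirchSwinnertonDyer-SmallImageMuTransfer"]
def PoitouTateSumLocalPairingsRat : Prop :=
  Literature.NumberTheory.GaloisCohomology.poitouTate_sum_localTatePairing_eq_zero ℚ

-- `PoitouTateSumLocalPairingsRat` holds: proved by `Summit.BirchSwinnertonDyer.BirchSwinnertonDyer.Theorems.smallImageMuTransfer_PoitouTateSumLocalPairingsRat_proof` (its module imports this route file, so no `_holds` link can be stated here).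

/-- item stmt-BirchSwinnertonDyer-19633 · assembly · rank 1 · closed · proved by Summit.BirchSwinnertonDyer.BirchSwinnertonDyer.Theorems.smallImageMuTransfer_Assembly_proof @ 9f5c70cd7864 (prover) · by planner
sources: Kato2004Asterisque, BurungaleCastellaSkinner2025, GreenbergLNM1716
[assembly] MuTransfer → AnalyticMuZeroX9 → SchneiderX9RankOne → PublishedInputsX9 → BSDpOnClassX9
(the rung-K6 leaf) -/
@[route_item "route-BirchSwinnertonDyer-SmallImageMuTransfer", crux]
def Assembly : Prop :=
  MuTransfer → AnalyticMuZeroX9 → SchneiderX9RankOne → PublishedInputsX9 → Summit.BirchSwinnertonDyer.BirchSwinnertonDyer.Rank1Residual.BSDpOnClassX9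

-- `Assembly` holds: proved by `Summit.BirchSwinnertonDyer.BirchSwinnertonDyer.Theorems.smallImageMuTransfer_Assembly_proof` @ 9f5c70cd7864 (its module imports this route file, so no `_holds` link can be stated here).

/-! D-0027 §2.1 — DECIDING THEOREM (planner-authored via `route open/edit --closes-file`; by planner-bsd-smallim-plan-g0-0 2026-08-25T22:02:58Z):
its hypotheses are this route's items and its conclusion the registered leaf `Summit.BirchSwinnertonDyer.BirchSwinnertonDyer.Rank1Residual.BSDpOnClassX9` (rung K6, D-0061) (glue_lint), and it elaborates with this file. -/

@[closes "route-BirchSwinnertonDyer-SmallImageMuTransfer"] theorem closes (hAsm : Assembly) (h1 : MuTransfer) (h2 : AnalyticMuZeroX9) (h3 : SchneiderX9RankOne)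
    (hP : PublishedInputsX9) :
    Summit.BirchSwinnertonDyer.BirchSwinnertonDyer.Rank1Residual.BSDpOnClassX9 := by
  -- `Assembly` (the route's join: μ-transfer ∧ analytic μ = 0 on X9 ∧ Schneider at the rank-1 X9
  -- pairs ∧ the published-fact bundle ⟹ the rung-K6 leaf) is itself an item, proved on the Theorems
  -- side by the kernel bridge `Rank1Residual.bsdpOnClassX9_of_katoMuTransfer` (p407118, sorry-free);
  -- the deciding theorem is its application, so every declared item is load-bearing (BC6).
  unfold Assembly at hAsm
  exact hAsm h1 h2 h3 hP

end Summit.BirchSwinnertonDyer.BirchSwinnertonDyer.Theses.SmallImageMuTransfer
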